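import Literature.MathematicalPhysics.QuantumFieldTheory.Balaban1983to89.B4Ineq112WalkRouteDeriv

/-!
# `Balaban1983to89.B4Ineq19WalkRoute` — [Balaban1983RegularityDecay] THEOREM (1.9), the HÖLDER member
# «|x−x′|^{−α}|U(A(Γ_{x,x′}))(D^η_{A,μ}G_k(Ω,A)f)(x′) − (D^η_{A,μ}G_k(Ω,A)f)(x)| ≤ c₀exp(−δ₀dist({x,x′},supp f))‖f‖_∞»
# and its δG clause (1.11)–(1.12), BY THE PRINTED §2 WALK ROUTE for an ARBITRARY LOCAL PROBE, END TO END on the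
# concrete operators, for EVERY region (pair) and EVERY configuration, modulo the per-cube inputs

statement-level skeleton of published theorems with citation tags; proofs where landed; nothing here is a claim about the Yang–Mills mass gap

CITATION HEADER.  T. Bałaban, *Regularity and decay of lattice Green's functions*, Commun. Math. Phys. **89** (1983)
571–597, doi:10.1007/bf01214744 [Balaban1983RegularityDecay] (cell paper B4; held text
`paper:balaban1983-cmp89-regularity-decay`, journal page = PDF page + 570; pp. 572–573, 576–579, 581).  Unit
`lit-balaban-r01` gen 6 (B4 fold owner), HOME `run/shared/lean/pub/lit-balaban/`, SKELETON rows **B4.Thm@573** ((1.9) and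
the Hölder member of (1.11)–(1.12)), **B4.Eq2.14**, **B4.Eq2.18**, **B4.Cor2.3**.  Theorems only; imports
`B4Ineq112WalkRouteDeriv` (→ `B4Ineq112WalkRoute`, `B4Ineq110WalkRouteDeriv`, `B4Ineq110WalkRoute`, `B4Eq212SmallR`,
`B4Eq213ConcreteWalk`, `B4RandomWalkDelta112`).  Norm: Mathlib's scope `Matrix.Norms.Operator` (`ℓ^∞ → ℓ^∞` over sites AND
colours).

WHAT IS PRINTED (verbatim).  p. 573: *«Theorem (Proposition 2.1 of [1]). For α < 1 there exist positive constants
δ₀, c₀, R₀ independent of A, k, Ω and depending on d, M only, c₀ on α also, such that for e sufficiently small and for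
an arbitrary function f : Ω → R^N, we have
|x−x′|^{−α}|U(A(Γ_{x,x′}))(D^η_{A,μ}G_k(Ω,A)f)(x′) − (D^η_{A,μ}G_k(Ω,A)f)(x)| ≤ c₀exp(−δ₀dist({x,x′}, supp f))‖f‖_∞ (1.9)
for x, x′ ∈ Ω, and satisfying the condition dist({x,x′},Ω^c) ≥ R₀. … If Ω ⊂ Ω₀, then for δG_k(Ω,Ω₀,A) … we have the
inequalities (1.5) and (1.6)»* ⟦= (1.9), (1.10)⟧ *«… with the additional factor (1.12)»*; p. 577 (2.14): *«‖f‖_{1,α} =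
max{sup_x|f(x)|, sup_{x,μ}|(D^η_{A,μ}f)(x)|, sup_{x,x′,μ}|x−x′|^{−α}|U(A(Γ_{x,x′}))(D^η_{A,μ}f)(x′) − (D^η_{A,μ}f)(x)|}»*;
p. 578 (2.18): *«using (2.3), (2.4) and Lemma 2.2 we get ‖h_{ω₀}G_k(□_{ω₀},Ã_{ω₀})h_{ω₀}K_{ω₁}G_k(□_{ω₁},Ã_{ω₁})h_{ω₁} …
h_{ω_n}f‖_{1,α} ≤ c₁‖K_{ω₁}G_k(□_{ω₁},Ã_{ω₁})h_{ω₁} … h_{ω_n}f‖_∞»* — the FIRST letter carries the Hölder norm (constant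
`c₁`), the other letters the sup factor bounds (2.20); p. 579, verbatim: *«Thus the inequality (1.9) is proved, similarly the inequalities (1.10).»* (after (2.22) «where
n ≧ M⁻¹dist({x,x′},supp f) − 2»); taking the supremum over functions f with fixed support and over admissible x, x′
is OUR reading of that step (not a printed sentence).

WHAT THIS MODULE PROVES (all in full).
* §1, THE WALK ROUTE FOR AN ARBITRARY LOCAL PROBE — the common mechanism behind (1.9), (1.10) (value, derivative) and
  (1.11)–(1.12): for the concrete operators of `B4Ineq110WalkRoute.ineq110_value` and ANY matrix `P` («the probe»:
  evaluation at `x`, a covariant bond difference at `x`, a transported Hölder difference of bond differences, …) such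
  that `P·h_j = 0` except for the labels `j` of a set `S₀` of at most `m₀` cubes with `|x₀ − Mj|_∞ < ρM`, and a per-cube
  input `α_P ≥ ‖P·h_jG_jh_j‖` (print: `c₁` of (2.18)) together with the factor bound `β` ((2.20), `3^dβ ≤ e⁻¹` (2.21)):
  **`probe_bound`** `‖P·G_k(Ω,A)·1_F‖ ≤ 2m₀α_P·e^{ρ+13/8}·e^{−D/M}` for `D ≤ dist_∞(x₀, F)` (far: the walk bound
  `B4Eq212SmallR.concrete_walk_decay_exp`; near: `‖PG‖ ≤ ‖PG₀‖(1 − ‖R‖)⁻¹ ≤ 2m₀α_P` — no bound on `‖P‖` is needed);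
  **`probe_delta_bound`** (two regions `Ω ⊂ Ω₀` by the Neumann cut, two cube families):
  `‖P·(G_k(Ω,A) − G_k(Ω₀,A))·1_F‖ ≤ 4m₀α_P·e^{ρ+29/8}·exp(−(D + D₀ + D₁)/(2M))` — the printed exponent
  «(2M)⁻¹(dist(x, supp f) + dist(x, Ω^c) + dist(supp f, Ω^c))» of p. 579 (interior cubes cancel,
  `B4Ineq112WalkRoute.interior_letters_agree`, `B4RandomWalkDelta112.lattice_walk_delta_bound`).
* §2, THE HÖLDER PROBE of (1.9)/(2.14) at the pair `x, x′` with bonds `b = ⟨x,y⟩`, `b′ = ⟨x′,y′⟩` and transport `U`: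
  `P_H = σ·(E_{xy′}[UW(x′,y′)] − E_{xx′}[U] − (E_{xy}[W(x,y)] − E_{xx}[1]))` (`σ` stands for `|x−x′|^{−α}`):
  `holderOp_eq` (`= σ·(E_{xx′}[U]·P_{b′} − P_b)`), `holderOp_mul_mulH`, `fld_holderOp_mulVec`
  (`(P_HΦ)(x) = σ·(U(W(x′,y′)φ(y′) − φ(x′)) − (W(x,y)φ(y) − φ(x)))`).
* §3, **`ineq19_holder`** — THEOREM (1.9): for `|x−y|_∞, |x−x′|_∞, |x′−y′|_∞ ≤ M/8`, ANY real `σ`, ANY `κ×κ` matrix `U`,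
  the per-cube Hölder input `γ_H ≥ ‖P_H·h_jG_jh_j‖` and `β`: `‖P_H·G_k(Ω,A)·1_F‖ ≤ 2^{d+3}e^{5/2}γ_H·e^{−D/M}`
  (`D ≤ dist_∞(x,F)`); **`ineq19_holder_apply`** (the printed shape on `f` supported in `F`, `sup|f| ≤ φ`);
  **`ineq112_holder`** / **`ineq112_holder_apply`** — the Hölder member of the δG clause (1.11)–(1.12):
  `‖P_H·δG_k(Ω,Ω₀,A)·1_F‖ ≤ 2^{d+4}e^{9/2}γ_H·exp(−(D + D₀ + D₁)/(2M))`.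

* §4 (v1.1), the Leibniz reduction (2.3)/(2.4) of the per-cube Hölder input: `holderOp_mul_mulH_expand` (`P_H·h = h(x)P_H +
  σ(h(x′)−h(x))·E_{xx′}[U]P_{b′} + σ(h(y′)−h(x′))·E_{xy′}[UW′] − σ(h(y)−h(x))·E_{xy}[W]`) and **`norm_holderOp_letter_le`**
  (`‖P_H·(hGh)‖ ≤ γ_H′ + θ_aγ_T + 2θ_bγ_V` from the Hölder/derivative/value inputs on `G` itself and the weighted increments
  of `h`).

HONEST SCOPE.  (i) The per-cube inputs are ASSUMED for every cube (both families for δG): `α_P`/`γ_H` is the print's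
`c₁` of (2.18) — the `(∞ → 1,α)` size of the localized cube propagator `h_jG_k(□_j,Ã_j)h_j` (Lemma 2.2 (2.16) after the
Leibniz rules (2.3)/(2.4)) —, `β` the factor bound (2.20)/(2.21); producing them (Lemmas 2.1/2.2 at `Ã_j` in these
norms on these carriers) is reserve item R9 at `A ≠ 0`; hence no `R₀` and no `e`.  (ii) The pair `x, x′` and the two
bonds lie within `M/8` of each other (for `|x−x′| > M/8` the Hölder quotient is bounded by the derivative member
`B4Ineq110WalkRouteDeriv.ineq110_deriv` at `x` and at `x′` separately, `|x−x′|^{−α} ≤ (8/M)^α`); `σ` and `U` are free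
parameters (the bound is carried entirely by the input `γ_H`), so nothing about `α < 1` or the orthogonality of `U` is
used or claimed here.  (iii) `Ω ⊂ Ω₀` is modelled by the Neumann cut inside the common site set, as in
`B4Ineq112WalkRoute`.  No `def`, no `Prop` fact, no `sorry`; axioms standard.
-/

namespace Literature.MathematicalPhysics.QuantumFieldTheory.Balaban1983to89.B4Ineq19WalkRoute

open Literature.MathematicalPhysics.QuantumFieldTheory.Balaban1983to89.B4GaugeCovariance
open Literature.MathematicalPhysics.QuantumFieldTheory.Balaban1983to89.B4Commutators25to211
open Literature.MathematicalPhysics.QuantumFieldTheory.Balaban1983to89.B4PartitionUnity22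
open Literature.MathematicalPhysics.QuantumFieldTheory.Balaban1983to89.B4RandomWalk213
open Literature.MathematicalPhysics.QuantumFieldTheory.Balaban1983to89.B4RandomWalkDelta112
open Literature.MathematicalPhysics.QuantumFieldTheory.Balaban1983to89.B4LpChain221
open Literature.MathematicalPhysics.QuantumFieldTheory.Balaban1983to89.B4Eq213Locality
open Literature.MathematicalPhysics.QuantumFieldTheory.Balaban1983to89.B4Eq26Locality
open Literature.MathematicalPhysics.QuantumFieldTheory.Balaban1983to89.B4Eq213ConcreteWalk
open Literature.MathematicalPhysics.QuantumFieldTheory.Balaban1983to89.B4Eq212SmallR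
open Literature.MathematicalPhysics.QuantumFieldTheory.Balaban1983to89.B4Ineq110WalkRoute
open Literature.MathematicalPhysics.QuantumFieldTheory.Balaban1983to89.B4Ineq112WalkRoute
open Literature.MathematicalPhysics.QuantumFieldTheory.Balaban1983to89.B4Ineq110WalkRouteDeriv
open scoped Matrix NNReal

open scoped Matrix.Norms.Operator

/-! ## §0. Norm plumbing -/

section Norm

variable {m n : Type*} [Fintype m] [Fintype n]

/-- a row sum is at most the `ℓ^∞`-operator norm. [folklore] -/
private theorem row_sum_le_norm (A : Matrix m n ℝ) (i : m) : ∑ j, |A i j| ≤ ‖A‖ := by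
  rw [Matrix.linfty_opNorm_def]
  have h : (∑ j, ‖A i j‖₊ : ℝ≥0) ≤ Finset.univ.sup fun i => ∑ j, ‖A i j‖₊ :=
    Finset.le_sup (f := fun i => ∑ j, ‖A i j‖₊) (Finset.mem_univ i)
  have h' := NNReal.coe_le_coe.mpr h
  simp only [NNReal.coe_sum, coe_nnnorm, Real.norm_eq_abs] at h'
  exact h'

/-- `|(Af)_i| ≤ ‖A‖·sup|f|`. [folklore] -/
private theorem abs_mulVec_le (A : Matrix m n ℝ) (f : n → ℝ) {φ : ℝ} (hφ : 0 ≤ φ) (hf : ∀ j, |f j| ≤ φ)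
    (i : m) : |(A *ᵥ f) i| ≤ ‖A‖ * φ := by
  rw [Matrix.mulVec, dotProduct]
  calc |∑ j, A i j * f j| ≤ ∑ j, |A i j * f j| := Finset.abs_sum_le_sum_abs _ _
    _ ≤ ∑ j, |A i j| * φ := Finset.sum_le_sum fun j _ => by
        rw [abs_mul]; exact mul_le_mul_of_nonneg_left (hf j) (abs_nonneg _)
    _ = (∑ j, |A i j|) * φ := by rw [Finset.sum_mul]
    _ ≤ ‖A‖ * φ := mul_le_mul_of_nonneg_right (row_sum_le_norm A i) hφ

end Norm

/-! ## §1. The walk route for an arbitrary local probe `P` -/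

section Probe

variable {X Y κ : Type*} [Fintype X] [Fintype Y] [Fintype κ] [DecidableEq X] [DecidableEq κ] {d : ℕ}

/-- `e⁻¹ ≤ 1/2`. [folklore] -/
private theorem exp_neg_one_le_half : Real.exp (-1) ≤ 1 / 2 := by
  have h := Real.add_one_le_exp (1 : ℝ)
  rw [Real.exp_neg, inv_eq_one_div]
  exact one_div_le_one_div_of_le (by norm_num) (by linarith)

/-- **THE §2 WALK ROUTE FOR AN ARBITRARY LOCAL PROBE.**  Concrete data as in `B4Ineq110WalkRoute.ineq110_value` (sites
`X` with positions at scale `M`, `H = covOp c m² a q W T` (1.6) with `G·H = 1`, the constructed partition of unity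
`h_j`, block-compatible Neumann-cut cube operators with inverses `G_j`, factor bounds `‖K_jG_jh_j‖ ≤ β`,
(2.21) `3^dβ ≤ e⁻¹`).  A PROBE is any matrix `P` with `P·h_j = 0` for the labels `j` outside a set `S₀` of at most `m₀`
cubes, all with `|x₀ − Mj|_∞ < ρM`, and with the per-cube input `‖P·h_jG_jh_j‖ ≤ α_P` (print: the constant `c₁` of
(2.18) carried by the first letter).  Then for every site set `F` and every `D ≤ dist_∞(x₀, F)`:
`‖P·G_k(Ω,A)·1_F‖ ≤ 2m₀α_P·e^{ρ+13/8}·e^{−D/M}`.  Far from `F` (`D/M ≥ ρ + 13/8`): the walk bound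
`B4Eq212SmallR.concrete_walk_decay_exp` (walks start in `S₀`, label separation `⌊D/M − ρ − 5/8⌋` to the cubes seeing
`F`, tail (2.22)); near `F`: `P·G·(1 − R) = P·G₀ = Σ_{j∈S₀}P·h_jG_jh_j` gives `‖P·G‖ ≤ m₀α_P(1 − ‖R‖)⁻¹ ≤ 2m₀α_P`
(`B4Ineq110WalkRoute.norm_le_of_neumann`, `‖R‖ ≤ 2^dβ ≤ 1/2`) — no bound on `‖P‖` itself is needed.
[cite: Balaban1983RegularityDecay, (2.13) p.577, (2.18)–(2.22) pp.578–579, Theorem p.573] -/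
theorem probe_bound {M : ℝ} (hM : 0 < M) (pos : X → Fin d → ℝ) (c : X → X → ℝ) (m2 a : ℝ)
    (q : Y → X → ℝ) (W : X → X → Matrix κ κ ℝ) (T : Y → X → Matrix κ κ ℝ)
    (hc : ∀ x z', c x z' ≠ 0 → ∀ μ, |pos x μ - pos z' μ| ≤ 1 / 8 * M)
    (hq : ∀ y x z', q y x ≠ 0 → q y z' ≠ 0 → ∀ μ, |pos x μ - pos z' μ| ≤ 1 / 8 * M)
    (s : Finset (Fin d → ℤ)) (hs : ∀ j x, hCube M j (pos x) ≠ 0 → j ∈ s)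
    (S : (Fin d → ℤ) → X → Prop) [∀ j, DecidablePred (S j)]
    (hS : ∀ j z, (∀ μ, |pos z μ - M * j μ| ≤ 7 / 8 * M) → S j z)
    (W' : (Fin d → ℤ) → X → X → Matrix κ κ ℝ) (T' : (Fin d → ℤ) → Y → X → Matrix κ κ ℝ)
    (hWW' : ∀ j x z', (∀ μ, |pos x μ - M * j μ| ≤ 3 / 4 * M) → (∀ μ, |pos z' μ - M * j μ| ≤ 3 / 4 * M) →
      W' j x z' = W x z')
    (hTT' : ∀ j y x, q y x ≠ 0 → (∀ μ, |pos x μ - M * j μ| ≤ 3 / 4 * M) → T' j y x = T y x)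
    (Gj : (Fin d → ℤ) → Matrix (X × κ) (X × κ) ℝ)
    (hGj : ∀ j ∈ s, covOp (fun z z' => if (S j z ↔ S j z') then c z z' else 0) m2 a q (W' j) (T' j) * Gj j = 1)
    (G : Matrix (X × κ) (X × κ) ℝ) (hGH : G * covOp c m2 a q W T = 1)
    -- the probe
    (P : Matrix (X × κ) (X × κ) ℝ) (S₀ : Finset ↥s) {m₀ : ℕ} (hcard : S₀.card ≤ m₀)
    (hP0 : ∀ i : ↥s, i ∉ S₀ → P * mulH (ι := κ) (fun z => hCube M i.1 (pos z)) = 0)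
    (x₀ : X) {ρ : ℝ} (hS₀ρ : ∀ i ∈ S₀, ∀ μ, |pos x₀ μ - M * i.1 μ| < ρ * M)
    -- the analytic inputs
    {αP β : ℝ} (hαP0 : 0 ≤ αP)
    (hαP : ∀ i : ↥s, ‖P * (mulH (ι := κ) (fun z => hCube M i.1 (pos z)) * Gj i.1
        * mulH (ι := κ) (fun z => hCube M i.1 (pos z)))‖ ≤ αP) (hβ0 : 0 ≤ β)
    (hβ : ∀ i : ↥s, ‖opK (fun z z' => if (S i.1 z ↔ S i.1 z') then c z z' else 0) m2 a q (W' i.1) (T' i.1)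
        (fun z => hCube M i.1 (pos z)) * Gj i.1 * mulH (ι := κ) (fun z => hCube M i.1 (pos z))‖ ≤ β)
    (h3β : (3 : ℝ) ^ d * β ≤ Real.exp (-1))
    -- the support set and its separation from `x₀`
    (F : X → Prop) [DecidablePred F] {D : ℝ} (hD : ∀ x', F x' → ∃ μ, D ≤ |pos x₀ μ - pos x' μ|) :
    ‖P * G * mulH (ι := κ) (fun z => if F z then (1 : ℝ) else 0)‖
      ≤ 2 * m₀ * αP * Real.exp (ρ + 13 / 8) * Real.exp (-(D / M)) := by
  classical
  -- the letters
  set h : (Fin d → ℤ) → X → ℝ := fun j z => hCube M j (pos z) with hh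
  set cut : (Fin d → ℤ) → X → X → ℝ := fun j z z' => if (S j z ↔ S j z') then c z z' else 0 with hcut
  set aJ : (Fin d → ℤ) → Matrix (X × κ) (X × κ) ℝ :=
    fun j => mulH (ι := κ) (h j) * Gj j * mulH (ι := κ) (h j) with haJ
  set bJ : (Fin d → ℤ) → Matrix (X × κ) (X × κ) ℝ :=
    fun j => opK (cut j) m2 a q (W' j) (T' j) (h j) * Gj j * mulH (ι := κ) (h j) with hbJ
  set P' : Matrix (X × κ) (X × κ) ℝ := mulH (ι := κ) (fun z => if F z then (1 : ℝ) else 0) with hP'def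
  have hnP' : ‖P'‖ ≤ 1 := norm_mulH_le _ zero_le_one fun z => by
    by_cases hz : F z <;> simp [hz]
  -- the probe sees only the cubes of `S₀`
  have hPa0 : ∀ i : ↥s, i ∉ S₀ → P * aJ i.1 = 0 := by
    intro i hi
    simp only [haJ]
    rw [← Matrix.mul_assoc, ← Matrix.mul_assoc, hP0 i hi, Matrix.zero_mul, Matrix.zero_mul]
  -- `‖R‖ ≤ 2^dβ ≤ 1/2`, `G(1 − R) = G₀`
  have hR2 : ‖∑ j ∈ s, bJ j‖ ≤ (2 : ℝ) ^ d * β := norm_R_le hM pos c m2 a q hc hq s S W' T' Gj hβ0 hβ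
  have h23 : (2 : ℝ) ^ d * β ≤ (3 : ℝ) ^ d * β :=
    mul_le_mul_of_nonneg_right (pow_le_pow_left₀ (by norm_num) (by norm_num) d) hβ0
  have hRhalf : ‖∑ j ∈ s, bJ j‖ ≤ 1 / 2 := (hR2.trans h23).trans (h3β.trans exp_neg_one_le_half)
  have hRlt : ‖∑ j ∈ s, bJ j‖ < 1 := hRhalf.trans_lt (by norm_num)
  have h211 : covOp c m2 a q W T * ∑ j ∈ s, aJ j = 1 - ∑ j ∈ s, bJ j :=
    parametrix_identity_hCube hM pos c m2 a q W T s hs S hS hc hq W' T' hWW' hTT' Gj hGj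
  have hGeq : G * (1 - ∑ j ∈ s, bJ j) = ∑ j ∈ s, aJ j := G_mul_one_sub_eq hGH h211
  -- `‖P·G₀‖ ≤ m₀α_P` and `‖P·G‖ ≤ 2m₀α_P`
  have hPG0 : ‖P * ∑ j ∈ s, aJ j‖ ≤ m₀ * αP := by
    have hsum_eq : P * ∑ j ∈ s, aJ j = ∑ i ∈ S₀, P * aJ i.1 := by
      rw [Finset.mul_sum, ← Finset.sum_coe_sort s (fun j => P * aJ j)]
      symm
      exact Finset.sum_subset (Finset.subset_univ S₀) fun i _ hi => hPa0 i hi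
    rw [hsum_eq]
    calc ‖∑ i ∈ S₀, P * aJ i.1‖ ≤ ∑ i ∈ S₀, ‖P * aJ i.1‖ := norm_sum_le _ _
      _ ≤ ∑ i ∈ S₀, αP := Finset.sum_le_sum fun i _ => hαP i
      _ = S₀.card * αP := by rw [Finset.sum_const, nsmul_eq_mul]
      _ ≤ m₀ * αP := mul_le_mul_of_nonneg_right (by exact_mod_cast hcard) hαP0
  have hPG : ‖P * G‖ ≤ 2 * m₀ * αP := by
    have hPGeq : P * G * (1 - ∑ j ∈ s, bJ j) = P * ∑ j ∈ s, aJ j := by rw [Matrix.mul_assoc, hGeq]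
    have h1 := norm_le_of_neumann hRlt hPGeq
    have hinv : (1 - ‖∑ j ∈ s, bJ j‖)⁻¹ ≤ 2 := (inv_le_comm₀ (by linarith) two_pos).mpr (by linarith)
    calc ‖P * G‖ ≤ ‖P * ∑ j ∈ s, aJ j‖ * (1 - ‖∑ j ∈ s, bJ j‖)⁻¹ := h1
      _ ≤ (m₀ * αP) * 2 := mul_le_mul hPG0 hinv (inv_nonneg.mpr (by linarith)) (by positivity)
      _ = 2 * m₀ * αP := by ring
  -- the exponent bookkeeping
  have hexp : Real.exp (-1) * (2 * Real.exp 2 * Real.exp (-(D / M - ρ - 5 / 8)))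
      = 2 * Real.exp (ρ + 13 / 8) * Real.exp (-(D / M)) := by
    rw [show ρ + 13 / 8 = (-1 + 2) + (ρ + 5 / 8) by ring,
      show -(D / M - ρ - 5 / 8) = (ρ + 5 / 8) + -(D / M) by ring]
    simp only [Real.exp_add]
    ring
  have hmα : 0 ≤ (m₀ : ℝ) * αP := by positivity
  by_cases hfar : 1 ≤ ⌊D / M - ρ - 5 / 8⌋₊
  · -- FAR FROM THE SUPPORT
    set N : ℕ := ⌊D / M - ρ - 5 / 8⌋₊ with hNdef
    have hDM : 1 ≤ D / M - ρ - 5 / 8 := by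
      by_contra hlt
      rw [not_le] at hlt
      have : N = 0 := Nat.floor_eq_zero.mpr hlt
      omega
    have hNle : (N : ℝ) ≤ D / M - ρ - 5 / 8 := Nat.floor_le (by linarith)
    have hNlt : D / M - ρ - 5 / 8 < N + 1 := Nat.lt_floor_add_one _
    have hND : ((N : ℝ) + ρ + 5 / 8) * M ≤ D := by
      have : (N : ℝ) + ρ + 5 / 8 ≤ D / M := by linarith
      rwa [le_div_iff₀ hM] at this
    set S₁ : Finset ↥s := Finset.univ.filter fun i : ↥s => ∃ x', F x' ∧ h i.1 x' ≠ 0 with hS₁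
    have hF0 : ∀ i : ↥s, i ∉ S₁ → mulH (ι := κ) (h i.1) * P' = 0 := by
      intro i hi
      rw [hP'def, mulH_mul_mulH]
      refine mulH_eq_zero_of fun z => ?_
      by_cases hz : F z
      · have hiz : h i.1 z = 0 := by
          by_contra hne
          exact hi (Finset.mem_filter.mpr ⟨Finset.mem_univ _, z, hz, hne⟩)
        rw [hiz, zero_mul]
      · rw [if_neg hz, mul_zero]
    have hP'a : ∀ i : ↥s, i ∉ S₁ → aJ i.1 * P' = 0 := by
      intro i hi
      simp only [haJ]
      rw [Matrix.mul_assoc, hF0 i hi, Matrix.mul_zero]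
    have hP'b : ∀ i : ↥s, i ∉ S₁ → bJ i.1 * P' = 0 := by
      intro i hi
      simp only [hbJ]
      rw [Matrix.mul_assoc, hF0 i hi, Matrix.mul_zero]
    have hβ₁ : ∀ i : ↥s, ‖bJ i.1 * P'‖ ≤ β := fun i =>
      (norm_mul_le _ _).trans (by
        calc ‖bJ i.1‖ * ‖P'‖ ≤ β * 1 := mul_le_mul (hβ i) hnP' (norm_nonneg _) hβ0
          _ = β := mul_one β)
    have hsep : ∀ i ∈ S₀, ∀ l ∈ S₁, ∃ μ, (N : ℤ) ≤ |i.1 μ - l.1 μ| := by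
      intro i hi l hl
      obtain ⟨-, x', hFx', hlx'⟩ := Finset.mem_filter.mp hl
      obtain ⟨μ, hμ⟩ := hD x' hFx'
      refine ⟨μ, ?_⟩
      have h1 : |pos x₀ μ - M * i.1 μ| < ρ * M := hS₀ρ i hi μ
      have h2 : |pos x' μ - M * l.1 μ| < 5 / 8 * M := hCube_ne_zero_imp hM hlx' μ
      have h3 : ((N : ℝ) + ρ + 5 / 8) * M ≤ |pos x₀ μ - pos x' μ| := hND.trans hμ
      have htri : |pos x₀ μ - pos x' μ|
          ≤ |pos x₀ μ - M * i.1 μ| + |M * i.1 μ - M * l.1 μ| + |pos x' μ - M * l.1 μ| := by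
        calc |pos x₀ μ - pos x' μ|
            = |(pos x₀ μ - M * i.1 μ) + (M * i.1 μ - M * l.1 μ) + (M * l.1 μ - pos x' μ)| := by ring_nf
          _ ≤ |pos x₀ μ - M * i.1 μ| + |M * i.1 μ - M * l.1 μ| + |M * l.1 μ - pos x' μ| := abs_add_three _ _ _
          _ = _ := by rw [abs_sub_comm (M * l.1 μ) (pos x' μ)]
      have h4 : (N : ℝ) * M < |M * i.1 μ - M * l.1 μ| := by linarith
      rw [← mul_sub, abs_mul, abs_of_pos hM] at h4
      have h5 : (N : ℝ) < |((i.1 μ : ℤ) : ℝ) - l.1 μ| := lt_of_mul_lt_mul_right (by linarith) hM.le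
      have h6 : ((N : ℤ) : ℝ) < (|i.1 μ - l.1 μ| : ℤ) := by push_cast; exact h5
      exact (Int.cast_lt.mp h6).le
    have hr : ((N : ℝ) + 1) - 2 ≤ ((N - 1 : ℕ) : ℝ) := by
      rw [Nat.cast_sub hfar, Nat.cast_one]; linarith
    have hwalk := concrete_walk_decay_exp hM pos c m2 a q W T hc hq s hs S hS W' T' hWW' hTT' Gj hGj G hGH
      (P := P) (P' := P') (S₀ := S₀) (S₁ := S₁) (α := αP) (β := β) (β₁ := β) (N := N)
      (fun i hi => hPa0 i hi) hP'a hP'b hαP hβ0 hβ hβ₁ h3β hfar hsep hr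
    have hEN : Real.exp (-((N : ℝ) + 1)) ≤ Real.exp (-(D / M - ρ - 5 / 8)) :=
      Real.exp_le_exp.mpr (by linarith)
    have hC1 : (S₀.card : ℝ) * αP * β * (3 : ℝ) ^ d ≤ (m₀ : ℝ) * αP * β * (3 : ℝ) ^ d := by
      have h1 : (S₀.card : ℝ) ≤ (m₀ : ℝ) := by exact_mod_cast hcard
      exact mul_le_mul_of_nonneg_right (mul_le_mul_of_nonneg_right
        (mul_le_mul_of_nonneg_right h1 hαP0) hβ0) (by positivity)
    have hC2 : 2 * Real.exp 2 * Real.exp (-((N : ℝ) + 1)) ≤ 2 * Real.exp 2 * Real.exp (-(D / M - ρ - 5 / 8)) :=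
      mul_le_mul_of_nonneg_left hEN (by positivity)
    have hC3 : ((3 : ℝ) ^ d * β) * (2 * Real.exp 2 * Real.exp (-(D / M - ρ - 5 / 8)))
        ≤ Real.exp (-1) * (2 * Real.exp 2 * Real.exp (-(D / M - ρ - 5 / 8))) :=
      mul_le_mul_of_nonneg_right h3β (by positivity)
    calc ‖P * G * P'‖
        ≤ S₀.card * αP * β * (3 : ℝ) ^ d * (2 * Real.exp 2 * Real.exp (-((N : ℝ) + 1))) := hwalk
      _ ≤ (m₀ : ℝ) * αP * β * (3 : ℝ) ^ d * (2 * Real.exp 2 * Real.exp (-(D / M - ρ - 5 / 8))) :=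
          mul_le_mul hC1 hC2 (by positivity) (by positivity)
      _ = (m₀ : ℝ) * αP * (((3 : ℝ) ^ d * β) * (2 * Real.exp 2 * Real.exp (-(D / M - ρ - 5 / 8)))) := by ring
      _ ≤ (m₀ : ℝ) * αP * (Real.exp (-1) * (2 * Real.exp 2 * Real.exp (-(D / M - ρ - 5 / 8)))) :=
          mul_le_mul_of_nonneg_left hC3 hmα
      _ = 2 * m₀ * αP * Real.exp (ρ + 13 / 8) * Real.exp (-(D / M)) := by rw [hexp]; ring
  · -- NEAR THE SUPPORT (`D/M < ρ + 13/8`)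
    rw [not_le, Nat.lt_one_iff, Nat.floor_eq_zero] at hfar
    have hE : 1 ≤ Real.exp (ρ + 13 / 8) * Real.exp (-(D / M)) := by
      rw [← Real.exp_add]
      exact Real.one_le_exp_iff.mpr (by linarith)
    calc ‖P * G * P'‖ ≤ ‖P * G‖ * ‖P'‖ := norm_mul_le _ _
      _ ≤ (2 * m₀ * αP) * 1 := mul_le_mul hPG hnP' (norm_nonneg _) (by positivity)
      _ ≤ (2 * m₀ * αP) * (Real.exp (ρ + 13 / 8) * Real.exp (-(D / M))) :=
          mul_le_mul_of_nonneg_left hE (by positivity)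
      _ = 2 * m₀ * αP * Real.exp (ρ + 13 / 8) * Real.exp (-(D / M)) := by ring

-- both walk expansions are unfolded in one statement: twice the budget of `probe_bound`
set_option maxHeartbeats 400000 in
/-- **THE WALK ROUTE FOR AN ARBITRARY LOCAL PROBE, δG VERSION** («with the additional factor (1.12)», p. 573; p. 579
«The terms with ω such that □_{ω_i} are interior cubes of Ω are the same in both representations, so they cancel»).
Setting of `B4Ineq112WalkRoute.ineq112_value` (sites `X` of `Ω₀`, `H = covOp c …` with inverse `G′ = G_k(Ω₀,A)`, the
sub-region `Ω` through the Neumann cut `c^Ω` with inverse `G`, block-compatible cube sets `S_j`, the two cube families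
`G_j`, `G_j^Ω`, factor bounds `≤ β` for both, `3^dβ ≤ e⁻¹`) and a probe `P` as in `probe_bound` (`P·h_j = 0` off at most
`m₀` cubes within `ρM` of `x₀`) with the per-cube input `α_P ≥ ‖P·h_jG_jh_j‖, ‖P·h_jG_j^Ωh_j‖`.  Then for every site set
`F` and reals `D ≤ dist_∞(x₀,F)`, `D₀ ≤ dist_∞(x₀,Ω^c)`, `D₁ ≤ dist_∞(F,Ω^c)`:
`‖P·(G_k(Ω,A) − G_k(Ω₀,A))·1_F‖ ≤ 4m₀α_P·e^{ρ+29/8}·exp(−(D + D₀ + D₁)/(2M))`.  Far: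
`B4RandomWalkDelta112.lattice_walk_delta_bound` over `↥s` (interior labels cancel by
`B4Ineq112WalkRoute.interior_letters_agree`; every surviving walk passes a cube meeting `Ω^c`, label separation
`⌊(D + D₀ + D₁)/(2M) − ρ − 21/8⌋` through it); near: `‖PG‖ + ‖PG′‖ ≤ 4m₀α_P`.
[cite: Balaban1983RegularityDecay, Theorem (1.11)–(1.12) p.573; p.579 (between (2.22) and (2.23)); Cor. 2.3 p.581] -/
theorem probe_delta_bound {M : ℝ} (hM : 0 < M) (pos : X → Fin d → ℝ) (c : X → X → ℝ) (m2 a : ℝ)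
    (q : Y → X → ℝ) (W : X → X → Matrix κ κ ℝ) (T : Y → X → Matrix κ κ ℝ)
    (hc : ∀ x z', c x z' ≠ 0 → ∀ μ, |pos x μ - pos z' μ| ≤ 1 / 8 * M)
    (hq : ∀ y x z', q y x ≠ 0 → q y z' ≠ 0 → ∀ μ, |pos x μ - pos z' μ| ≤ 1 / 8 * M)
    (s : Finset (Fin d → ℤ)) (hs : ∀ j x, hCube M j (pos x) ≠ 0 → j ∈ s)
    (S : (Fin d → ℤ) → X → Prop) [∀ j, DecidablePred (S j)]
    (hS : ∀ j z, (∀ μ, |pos z μ - M * j μ| ≤ 7 / 8 * M) → S j z)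
    (hS1 : ∀ j z, S j z → ∀ μ, |pos z μ - M * j μ| ≤ M)
    (hSq : ∀ j y z z', q y z ≠ 0 → q y z' ≠ 0 → (S j z ↔ S j z'))
    (W' : (Fin d → ℤ) → X → X → Matrix κ κ ℝ) (T' : (Fin d → ℤ) → Y → X → Matrix κ κ ℝ)
    (hWW' : ∀ j x z', (∀ μ, |pos x μ - M * j μ| ≤ 3 / 4 * M) → (∀ μ, |pos z' μ - M * j μ| ≤ 3 / 4 * M) →
      W' j x z' = W x z')
    (hTT' : ∀ j y x, q y x ≠ 0 → (∀ μ, |pos x μ - M * j μ| ≤ 3 / 4 * M) → T' j y x = T y x)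
    (Ω : X → Prop) [DecidablePred Ω]
    (Gj : (Fin d → ℤ) → Matrix (X × κ) (X × κ) ℝ)
    (hGj : ∀ j ∈ s, covOp (fun z z' => if (S j z ↔ S j z') then c z z' else 0) m2 a q (W' j) (T' j) * Gj j = 1)
    (GjΩ : (Fin d → ℤ) → Matrix (X × κ) (X × κ) ℝ)
    (hGjΩ : ∀ j ∈ s, covOp (fun z z' => if (S j z ↔ S j z') then (if (Ω z ↔ Ω z') then c z z' else 0) else 0)
      m2 a q (W' j) (T' j) * GjΩ j = 1)
    (G : Matrix (X × κ) (X × κ) ℝ) (hGH : G * covOp (fun z z' => if (Ω z ↔ Ω z') then c z z' else 0) m2 a q W T = 1)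
    (G' : Matrix (X × κ) (X × κ) ℝ) (hG'H : G' * covOp c m2 a q W T = 1)
    -- the probe
    (P : Matrix (X × κ) (X × κ) ℝ) (S₀ : Finset ↥s) {m₀ : ℕ} (hcard : S₀.card ≤ m₀)
    (hP0 : ∀ i : ↥s, i ∉ S₀ → P * mulH (ι := κ) (fun z => hCube M i.1 (pos z)) = 0)
    (x₀ : X) {ρ : ℝ} (hS₀ρ : ∀ i ∈ S₀, ∀ μ, |pos x₀ μ - M * i.1 μ| < ρ * M)
    -- the per-cube inputs, for both families of cubes
    {αP β : ℝ} (hαP0 : 0 ≤ αP)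
    (hαP : ∀ i : ↥s, ‖P * (mulH (ι := κ) (fun z => hCube M i.1 (pos z)) * Gj i.1
        * mulH (ι := κ) (fun z => hCube M i.1 (pos z)))‖ ≤ αP)
    (hαPΩ : ∀ i : ↥s, ‖P * (mulH (ι := κ) (fun z => hCube M i.1 (pos z)) * GjΩ i.1
        * mulH (ι := κ) (fun z => hCube M i.1 (pos z)))‖ ≤ αP) (hβ0 : 0 ≤ β)
    (hβ : ∀ i : ↥s, ‖opK (fun z z' => if (S i.1 z ↔ S i.1 z') then c z z' else 0) m2 a q (W' i.1) (T' i.1)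
        (fun z => hCube M i.1 (pos z)) * Gj i.1 * mulH (ι := κ) (fun z => hCube M i.1 (pos z))‖ ≤ β)
    (hβΩ : ∀ i : ↥s, ‖opK (fun z z' => if (S i.1 z ↔ S i.1 z') then (if (Ω z ↔ Ω z') then c z z' else 0) else 0)
        m2 a q (W' i.1) (T' i.1) (fun z => hCube M i.1 (pos z)) * GjΩ i.1
        * mulH (ι := κ) (fun z => hCube M i.1 (pos z))‖ ≤ β)
    (h3β : (3 : ℝ) ^ d * β ≤ Real.exp (-1))
    -- the support set and the three separations
    (F : X → Prop) [DecidablePred F] {D D₀ D₁ : ℝ}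
    (hD : ∀ x', F x' → ∃ μ, D ≤ |pos x₀ μ - pos x' μ|)
    (hD₀ : ∀ x₁, ¬ Ω x₁ → ∃ μ, D₀ ≤ |pos x₀ μ - pos x₁ μ|)
    (hD₁ : ∀ x', F x' → ∀ x₁, ¬ Ω x₁ → ∃ μ, D₁ ≤ |pos x₁ μ - pos x' μ|) :
    ‖P * (G - G') * mulH (ι := κ) (fun z => if F z then (1 : ℝ) else 0)‖
      ≤ 4 * m₀ * αP * Real.exp (ρ + 29 / 8) * Real.exp (-((D + D₀ + D₁) / (2 * M))) := by
  classical
  -- the letters of the two expansions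
  set h : (Fin d → ℤ) → X → ℝ := fun j z => hCube M j (pos z) with hh
  set cΩ : X → X → ℝ := fun z z' => if (Ω z ↔ Ω z') then c z z' else 0 with hcΩ
  set cut : (Fin d → ℤ) → X → X → ℝ := fun j z z' => if (S j z ↔ S j z') then c z z' else 0 with hcut
  set cutΩ : (Fin d → ℤ) → X → X → ℝ := fun j z z' => if (S j z ↔ S j z') then cΩ z z' else 0 with hcutΩ
  set aJ : (Fin d → ℤ) → Matrix (X × κ) (X × κ) ℝ :=
    fun j => mulH (ι := κ) (h j) * Gj j * mulH (ι := κ) (h j) with haJ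
  set bJ : (Fin d → ℤ) → Matrix (X × κ) (X × κ) ℝ :=
    fun j => opK (cut j) m2 a q (W' j) (T' j) (h j) * Gj j * mulH (ι := κ) (h j) with hbJ
  set aΩ : (Fin d → ℤ) → Matrix (X × κ) (X × κ) ℝ :=
    fun j => mulH (ι := κ) (h j) * GjΩ j * mulH (ι := κ) (h j) with haΩ
  set bΩ : (Fin d → ℤ) → Matrix (X × κ) (X × κ) ℝ :=
    fun j => opK (cutΩ j) m2 a q (W' j) (T' j) (h j) * GjΩ j * mulH (ι := κ) (h j) with hbΩ
  set P' : Matrix (X × κ) (X × κ) ℝ := mulH (ι := κ) (fun z => if F z then (1 : ℝ) else 0) with hP'def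
  -- locality of the cut weights
  have hcΩloc : ∀ x z', cΩ x z' ≠ 0 → ∀ μ, |pos x μ - pos z' μ| ≤ 1 / 8 * M :=
    fun x z' hne μ => cut_local pos c Ω hc x z' hne μ
  have hM8 : 1 / 8 * M ≤ 3 / 4 * M := by nlinarith
  have hcut_loc : ∀ l z z', cut l z z' ≠ 0 → ∀ μ, |pos z μ - pos z' μ| ≤ 3 / 4 * M :=
    fun l z z' hne μ => (cut_local pos c (S l) hc z z' hne μ).trans hM8
  have hcutΩ_loc : ∀ l z z', cutΩ l z z' ≠ 0 → ∀ μ, |pos z μ - pos z' μ| ≤ 3 / 4 * M :=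
    fun l z z' hne μ => (cut_local pos cΩ (S l) hcΩloc z z' hne μ).trans hM8
  have hq_loc : ∀ y z z', q y z ≠ 0 → q y z' ≠ 0 → ∀ μ, |pos z μ - pos z' μ| ≤ 3 / 4 * M :=
    fun y z z' h1 h2 μ => (hq y z z' h1 h2 μ).trans hM8
  have hnP' : ‖P'‖ ≤ 1 := norm_mulH_le _ zero_le_one fun z => by
    by_cases hz : F z <;> simp [hz]
  -- the probe sees only the cubes of `S₀`
  have hP_gen : ∀ (Gx : Matrix (X × κ) (X × κ) ℝ) (i : ↥s), i ∉ S₀ →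
      P * (mulH (ι := κ) (h i.1) * Gx * mulH (ι := κ) (h i.1)) = 0 := by
    intro Gx i hi
    rw [← Matrix.mul_assoc, ← Matrix.mul_assoc, hP0 i hi, Matrix.zero_mul, Matrix.zero_mul]
  -- `‖R‖, ‖R′‖ ≤ 2^dβ ≤ 1/2`
  have h23 : (2 : ℝ) ^ d * β ≤ (3 : ℝ) ^ d * β :=
    mul_le_mul_of_nonneg_right (pow_le_pow_left₀ (by norm_num) (by norm_num) d) hβ0
  have h3β' : (3 : ℝ) ^ d * β < 1 := h3β.trans_lt (Real.exp_lt_one_iff.mpr (by norm_num))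
  have hRhalf : ‖∑ j ∈ s, bJ j‖ ≤ 1 / 2 :=
    ((norm_R_le hM pos c m2 a q hc hq s S W' T' Gj hβ0 hβ).trans h23).trans (h3β.trans exp_neg_one_le_half)
  have hRΩhalf : ‖∑ j ∈ s, bΩ j‖ ≤ 1 / 2 :=
    ((norm_R_le hM pos cΩ m2 a q hcΩloc hq s S W' T' GjΩ hβ0 hβΩ).trans h23).trans (h3β.trans exp_neg_one_le_half)
  have hRlt : ‖∑ j ∈ s, bJ j‖ < 1 := hRhalf.trans_lt (by norm_num)
  have hRΩlt : ‖∑ j ∈ s, bΩ j‖ < 1 := hRΩhalf.trans_lt (by norm_num)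
  -- (2.9)–(2.12) for both propagators
  have h211 : covOp c m2 a q W T * ∑ j ∈ s, aJ j = 1 - ∑ j ∈ s, bJ j :=
    parametrix_identity_hCube hM pos c m2 a q W T s hs S hS hc hq W' T' hWW' hTT' Gj hGj
  have h211Ω : covOp cΩ m2 a q W T * ∑ j ∈ s, aΩ j = 1 - ∑ j ∈ s, bΩ j :=
    parametrix_identity_hCube hM pos cΩ m2 a q W T s hs S hS hcΩloc hq W' T' hWW' hTT' GjΩ hGjΩ
  have hGeq : G' * (1 - ∑ j ∈ s, bJ j) = ∑ j ∈ s, aJ j := G_mul_one_sub_eq hG'H h211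
  have hGeqΩ : G * (1 - ∑ j ∈ s, bΩ j) = ∑ j ∈ s, aΩ j := G_mul_one_sub_eq hGH h211Ω
  have hsum : HasSum (fun n : ℕ => (∑ j ∈ s, aJ j) * (∑ j ∈ s, bJ j) ^ n) G' := hasSum_neumann hRlt hGeq
  have hsumΩ : HasSum (fun n : ℕ => (∑ j ∈ s, aΩ j) * (∑ j ∈ s, bΩ j) ^ n) G := hasSum_neumann hRΩlt hGeqΩ
  -- `‖P·G‖, ‖P·G′‖ ≤ 2m₀α_P`
  have hPG_gen : ∀ {Gbig Rx : Matrix (X × κ) (X × κ) ℝ} (ax : (Fin d → ℤ) → Matrix (X × κ) (X × κ) ℝ),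
      ‖Rx‖ ≤ 1 / 2 → Gbig * (1 - Rx) = ∑ j ∈ s, ax j → (∀ i : ↥s, i ∉ S₀ → P * ax i.1 = 0) →
      (∀ i : ↥s, ‖P * ax i.1‖ ≤ αP) → ‖P * Gbig‖ ≤ 2 * m₀ * αP := by
    intro Gbig Rx ax hRx hGx hax0 hax
    have hPG0 : ‖P * ∑ j ∈ s, ax j‖ ≤ m₀ * αP := by
      have hsum_eq : P * ∑ j ∈ s, ax j = ∑ i ∈ S₀, P * ax i.1 := by
        rw [Finset.mul_sum, ← Finset.sum_coe_sort s (fun j => P * ax j)]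
        symm
        exact Finset.sum_subset (Finset.subset_univ S₀) fun i _ hi => hax0 i hi
      rw [hsum_eq]
      calc ‖∑ i ∈ S₀, P * ax i.1‖ ≤ ∑ i ∈ S₀, ‖P * ax i.1‖ := norm_sum_le _ _
        _ ≤ ∑ i ∈ S₀, αP := Finset.sum_le_sum fun i _ => hax i
        _ = S₀.card * αP := by rw [Finset.sum_const, nsmul_eq_mul]
        _ ≤ m₀ * αP := mul_le_mul_of_nonneg_right (by exact_mod_cast hcard) hαP0
    have hPGeq : P * Gbig * (1 - Rx) = P * ∑ j ∈ s, ax j := by rw [Matrix.mul_assoc, hGx]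
    have h1 := norm_le_of_neumann (hRx.trans_lt (by norm_num)) hPGeq
    have hinv : (1 - ‖Rx‖)⁻¹ ≤ 2 := (inv_le_comm₀ (by linarith) two_pos).mpr (by linarith)
    calc ‖P * Gbig‖ ≤ ‖P * ∑ j ∈ s, ax j‖ * (1 - ‖Rx‖)⁻¹ := h1
      _ ≤ (m₀ * αP) * 2 := mul_le_mul hPG0 hinv (inv_nonneg.mpr (by linarith)) (by positivity)
      _ = 2 * m₀ * αP := by ring
  have hPG' : ‖P * G'‖ ≤ 2 * m₀ * αP :=
    hPG_gen aJ hRhalf hGeq (fun i hi => hP_gen (Gj i.1) i hi) hαP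
  have hPG : ‖P * G‖ ≤ 2 * m₀ * αP :=
    hPG_gen aΩ hRΩhalf hGeqΩ (fun i hi => hP_gen (GjΩ i.1) i hi) hαPΩ
  -- the exponent bookkeeping
  have hexp : Real.exp (-1) * (2 * Real.exp 2 * Real.exp (-((D + D₀ + D₁) / (2 * M) - ρ - 21 / 8)))
      = 2 * Real.exp (ρ + 29 / 8) * Real.exp (-((D + D₀ + D₁) / (2 * M))) := by
    rw [show ρ + 29 / 8 = (-1 + 2) + (ρ + 21 / 8) by ring,
      show -((D + D₀ + D₁) / (2 * M) - ρ - 21 / 8) = (ρ + 21 / 8) + -((D + D₀ + D₁) / (2 * M)) by ring]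
    simp only [Real.exp_add]
    ring
  have hmα : 0 ≤ (m₀ : ℝ) * αP := by positivity
  by_cases hfar : 1 ≤ ⌊(D + D₀ + D₁) / (2 * M) - ρ - 21 / 8⌋₊
  · -- FAR: the cancellation of the two walk expansions
    set N : ℕ := ⌊(D + D₀ + D₁) / (2 * M) - ρ - 21 / 8⌋₊ with hNdef
    have hSig : 1 ≤ (D + D₀ + D₁) / (2 * M) - ρ - 21 / 8 := by
      by_contra hlt
      rw [not_le] at hlt
      have : N = 0 := Nat.floor_eq_zero.mpr hlt
      omega
    have hNle : (N : ℝ) ≤ (D + D₀ + D₁) / (2 * M) - ρ - 21 / 8 := Nat.floor_le (by linarith)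
    have hNlt : (D + D₀ + D₁) / (2 * M) - ρ - 21 / 8 < N + 1 := Nat.lt_floor_add_one _
    have hNM : ((N : ℝ) + ρ + 21 / 8) * M ≤ (D + D₀ + D₁) / 2 := by
      have : (N : ℝ) + ρ + 21 / 8 ≤ (D + D₀ + D₁) / 2 / M := by rw [div_div]; linarith
      rwa [le_div_iff₀ hM] at this
    -- interior cubes and the cubes meeting `Ω^c`
    set TΩ : Finset ↥s := Finset.univ.filter fun j : ↥s => ∃ z, S j.1 z ∧ ¬ Ω z with hTΩ
    have hagree : ∀ j : ↥s, j ∉ TΩ → aΩ j.1 = aJ j.1 ∧ bΩ j.1 = bJ j.1 := by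
      intro j hj
      have hSΩ : ∀ z, S j.1 z → Ω z := by
        intro z hz
        by_contra hΩz
        exact hj (Finset.mem_filter.mpr ⟨Finset.mem_univ _, z, hz, hΩz⟩)
      have hsupp : ∀ z, h j.1 z ≠ 0 → S j.1 z := fun z hz =>
        hS j.1 z fun μ => (hCube_ne_zero_imp hM hz μ).le.trans (by nlinarith)
      have hag := interior_letters_agree c m2 a q (W' j.1) (T' j.1) (S j.1) Ω hSΩ (hSq j.1) (h j.1) hsupp
        (hGj j.1 j.2) (hGjΩ j.1 j.2)
      exact ⟨hag.1.symm, hag.2.symm⟩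
    -- the final cubes
    set S₁ : Finset ↥s := Finset.univ.filter fun i : ↥s => ∃ x', F x' ∧ h i.1 x' ≠ 0 with hS₁
    have hF0 : ∀ i : ↥s, i ∉ S₁ → mulH (ι := κ) (h i.1) * P' = 0 := by
      intro i hi
      rw [hP'def, mulH_mul_mulH]
      refine mulH_eq_zero_of fun z => ?_
      by_cases hz : F z
      · have hiz : h i.1 z = 0 := by
          by_contra hne
          exact hi (Finset.mem_filter.mpr ⟨Finset.mem_univ _, z, hz, hne⟩)
        rw [hiz, zero_mul]
      · rw [if_neg hz, mul_zero]
    have hP'_gen : ∀ (Kx : Matrix (X × κ) (X × κ) ℝ) (i : ↥s), i ∉ S₁ → Kx * mulH (ι := κ) (h i.1) * P' = 0 := by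
      intro Kx i hi
      rw [Matrix.mul_assoc, hF0 i hi, Matrix.mul_zero]
    have hβ₁_gen : ∀ (B : Matrix (X × κ) (X × κ) ℝ), ‖B‖ ≤ β → ‖B * P'‖ ≤ β := fun B hB =>
      (norm_mul_le _ _).trans (by
        calc ‖B‖ * ‖P'‖ ≤ β * 1 := mul_le_mul hB hnP' (norm_nonneg _) hβ0
          _ = β := mul_one β)
    -- the separation THROUGH a cube meeting `Ω^c`
    have hsep : ∀ i ∈ S₀, ∀ t ∈ TΩ, ∀ l ∈ S₁, ∃ μ ν, (N : ℤ) ≤ |i.1 μ - t.1 μ| + |t.1 ν - l.1 ν| := by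
      intro i hi t ht l hl
      obtain ⟨-, x₁, hSx₁, hΩx₁⟩ := Finset.mem_filter.mp ht
      obtain ⟨-, x', hFx', hlx'⟩ := Finset.mem_filter.mp hl
      have hiρ : ∀ μ, |pos x₀ μ - M * i.1 μ| < ρ * M := hS₀ρ i hi
      have ht1 : ∀ μ, |pos x₁ μ - M * t.1 μ| ≤ M := hS1 t.1 x₁ hSx₁
      have hl5 : ∀ μ, |pos x' μ - M * l.1 μ| < 5 / 8 * M := hCube_ne_zero_imp hM hlx'
      -- label distances from site distances
      have hit : ∀ μ, |pos x₀ μ - pos x₁ μ| - (ρ + 1) * M < M * |((i.1 μ : ℤ) : ℝ) - t.1 μ| := by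
        intro μ
        have htri : |pos x₀ μ - pos x₁ μ|
            ≤ |pos x₀ μ - M * i.1 μ| + |M * i.1 μ - M * t.1 μ| + |pos x₁ μ - M * t.1 μ| := by
          calc |pos x₀ μ - pos x₁ μ|
              = |(pos x₀ μ - M * i.1 μ) + (M * i.1 μ - M * t.1 μ) + (M * t.1 μ - pos x₁ μ)| := by ring_nf
            _ ≤ |pos x₀ μ - M * i.1 μ| + |M * i.1 μ - M * t.1 μ| + |M * t.1 μ - pos x₁ μ| := abs_add_three _ _ _
            _ = _ := by rw [abs_sub_comm (M * t.1 μ) (pos x₁ μ)]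
        rw [← mul_sub, abs_mul, abs_of_pos hM] at htri
        have := hiρ μ
        have := ht1 μ
        nlinarith
      have htl : ∀ ν, |pos x₁ ν - pos x' ν| - 13 / 8 * M < M * |((t.1 ν : ℤ) : ℝ) - l.1 ν| := by
        intro ν
        have htri : |pos x₁ ν - pos x' ν|
            ≤ |pos x₁ ν - M * t.1 ν| + |M * t.1 ν - M * l.1 ν| + |pos x' ν - M * l.1 ν| := by
          calc |pos x₁ ν - pos x' ν|
              = |(pos x₁ ν - M * t.1 ν) + (M * t.1 ν - M * l.1 ν) + (M * l.1 ν - pos x' ν)| := by ring_nf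
            _ ≤ |pos x₁ ν - M * t.1 ν| + |M * t.1 ν - M * l.1 ν| + |M * l.1 ν - pos x' ν| := abs_add_three _ _ _
            _ = _ := by rw [abs_sub_comm (M * l.1 ν) (pos x' ν)]
        rw [← mul_sub, abs_mul, abs_of_pos hM] at htri
        linarith [ht1 ν, hl5 ν]
      -- the two cases «max(D, D₀ + D₁) ≥ (D + D₀ + D₁)/2»
      have key : ∃ μ ν, (D + D₀ + D₁) / 2 ≤ |pos x₀ μ - pos x₁ μ| + |pos x₁ ν - pos x' ν| := by
        by_cases hcase : D ≤ D₀ + D₁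
        · obtain ⟨μ, hμ⟩ := hD₀ x₁ hΩx₁
          obtain ⟨ν, hν⟩ := hD₁ x' hFx' x₁ hΩx₁
          exact ⟨μ, ν, by linarith⟩
        · obtain ⟨μ, hμ⟩ := hD x' hFx'
          refine ⟨μ, μ, ?_⟩
          have htri : |pos x₀ μ - pos x' μ| ≤ |pos x₀ μ - pos x₁ μ| + |pos x₁ μ - pos x' μ| := by
            calc |pos x₀ μ - pos x' μ| = |(pos x₀ μ - pos x₁ μ) + (pos x₁ μ - pos x' μ)| := by ring_nf
              _ ≤ _ := abs_add_le _ _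
          linarith
      obtain ⟨μ, ν, hμν⟩ := key
      refine ⟨μ, ν, ?_⟩
      have hsum' : (N : ℝ) * M < M * |((i.1 μ : ℤ) : ℝ) - t.1 μ| + M * |((t.1 ν : ℤ) : ℝ) - l.1 ν| := by
        have := hit μ
        have := htl ν
        nlinarith
      rw [← mul_add] at hsum'
      have h5 : (N : ℝ) < |((i.1 μ : ℤ) : ℝ) - t.1 μ| + |((t.1 ν : ℤ) : ℝ) - l.1 ν| := by
        by_contra hle
        rw [not_lt] at hle
        have := mul_le_mul_of_nonneg_left hle hM.le
        linarith
      have h6 : ((N : ℤ) : ℝ) < ((|i.1 μ - t.1 μ| + |t.1 ν - l.1 ν| : ℤ) : ℝ) := by push_cast; exact h5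
      exact (Int.cast_lt.mp h6).le
    -- locality of the letters (non-neighbouring cubes)
    have hloc_gen : ∀ (cx : (Fin d → ℤ) → X → X → ℝ),
        (∀ l z z', cx l z z' ≠ 0 → ∀ μ, |pos z μ - pos z' μ| ≤ 3 / 4 * M) →
        ∀ i l : ↥s, ¬ cubeAdj (fun i : ↥s => i.1) i l →
          mulH (ι := κ) (h i.1) * opK (cx l.1) m2 a q (W' l.1) (T' l.1) (h l.1) = 0 :=
      fun cx hcx i l hil => mulH_hCube_mul_opK_eq_zero hM pos (cx l.1) m2 a q (W' l.1) (T' l.1) (hcx l.1) hq_loc hil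
    have hab_gen : ∀ (cx : (Fin d → ℤ) → X → X → ℝ) (Gx : (Fin d → ℤ) → Matrix (X × κ) (X × κ) ℝ),
        (∀ l z z', cx l z z' ≠ 0 → ∀ μ, |pos z μ - pos z' μ| ≤ 3 / 4 * M) →
        ∀ i l : ↥s, ¬ cubeAdj (fun i : ↥s => i.1) i l →
          (mulH (ι := κ) (h i.1) * Gx i.1 * mulH (ι := κ) (h i.1))
            * (opK (cx l.1) m2 a q (W' l.1) (T' l.1) (h l.1) * Gx l.1 * mulH (ι := κ) (h l.1)) = 0 := by
      intro cx Gx hcx i l hil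
      rw [show mulH (ι := κ) (h i.1) * Gx i.1 * mulH (ι := κ) (h i.1)
            * (opK (cx l.1) m2 a q (W' l.1) (T' l.1) (h l.1) * Gx l.1 * mulH (ι := κ) (h l.1))
          = mulH (ι := κ) (h i.1) * Gx i.1
            * (mulH (ι := κ) (h i.1) * opK (cx l.1) m2 a q (W' l.1) (T' l.1) (h l.1))
            * Gx l.1 * mulH (ι := κ) (h l.1) by simp only [Matrix.mul_assoc],
        hloc_gen cx hcx i l hil, Matrix.mul_zero, Matrix.zero_mul, Matrix.zero_mul]
    have hbb_gen : ∀ (cx : (Fin d → ℤ) → X → X → ℝ) (Gx : (Fin d → ℤ) → Matrix (X × κ) (X × κ) ℝ),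
        (∀ l z z', cx l z z' ≠ 0 → ∀ μ, |pos z μ - pos z' μ| ≤ 3 / 4 * M) →
        ∀ i l : ↥s, ¬ cubeAdj (fun i : ↥s => i.1) i l →
          (opK (cx i.1) m2 a q (W' i.1) (T' i.1) (h i.1) * Gx i.1 * mulH (ι := κ) (h i.1))
            * (opK (cx l.1) m2 a q (W' l.1) (T' l.1) (h l.1) * Gx l.1 * mulH (ι := κ) (h l.1)) = 0 := by
      intro cx Gx hcx i l hil
      rw [show opK (cx i.1) m2 a q (W' i.1) (T' i.1) (h i.1) * Gx i.1 * mulH (ι := κ) (h i.1)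
            * (opK (cx l.1) m2 a q (W' l.1) (T' l.1) (h l.1) * Gx l.1 * mulH (ι := κ) (h l.1))
          = opK (cx i.1) m2 a q (W' i.1) (T' i.1) (h i.1) * Gx i.1
            * (mulH (ι := κ) (h i.1) * opK (cx l.1) m2 a q (W' l.1) (T' l.1) (h l.1))
            * Gx l.1 * mulH (ι := κ) (h l.1) by simp only [Matrix.mul_assoc],
        hloc_gen cx hcx i l hil, Matrix.mul_zero, Matrix.zero_mul, Matrix.zero_mul]
    have hr : ((N : ℝ) + 1) - 2 ≤ ((N - 1 : ℕ) : ℝ) := by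
      rw [Nat.cast_sub hfar, Nat.cast_one]; linarith
    -- the abstract cancellation bound over the finite label type `↥s`
    have hwalk := lattice_walk_delta_bound (R := Matrix (X × κ) (X × κ) ℝ) (fun i : ↥s => i.1) Subtype.val_injective
      (a := fun i : ↥s => aΩ i.1) (b := fun i : ↥s => bΩ i.1) (a' := fun i : ↥s => aJ i.1) (b' := fun i : ↥s => bJ i.1)
      (P := P) (P' := P') (S₀ := S₀) (S₁ := S₁) (T := TΩ) (α := αP) (β := β) (β₁ := β) (N := N)
      (by rw [Finset.sum_coe_sort s aΩ]) (by rw [Finset.sum_coe_sort s bΩ])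
      (by rw [Finset.sum_coe_sort s aJ]) (by rw [Finset.sum_coe_sort s bJ]) hsumΩ hsum
      (hab_gen cutΩ GjΩ hcutΩ_loc) (hbb_gen cutΩ GjΩ hcutΩ_loc) (hab_gen cut Gj hcut_loc) (hbb_gen cut Gj hcut_loc)
      (fun i hi => (hagree i hi).1) (fun i hi => (hagree i hi).2)
      (fun i hi => hP_gen (GjΩ i.1) i hi) (fun i hi => hP_gen (Gj i.1) i hi)
      (fun i hi => hP'_gen _ i hi) (fun i hi => hP'_gen _ i hi) (fun i hi => hP'_gen _ i hi) (fun i hi => hP'_gen _ i hi)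
      hαPΩ hαP hβ0 hβΩ hβ (fun i => hβ₁_gen _ (hβΩ i)) (fun i => hβ₁_gen _ (hβ i)) h3β' hfar hsep
    rw [mul_div_assoc] at hwalk
    have htail := tail_222 (by positivity : 0 ≤ (3 : ℝ) ^ d * β) h3β hr
    have hEN : Real.exp (-((N : ℝ) + 1)) ≤ Real.exp (-((D + D₀ + D₁) / (2 * M) - ρ - 21 / 8)) :=
      Real.exp_le_exp.mpr (by linarith)
    have hC1 : (S₀.card : ℝ) * αP * β * (3 : ℝ) ^ d ≤ (m₀ : ℝ) * αP * β * (3 : ℝ) ^ d := by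
      have h1 : (S₀.card : ℝ) ≤ (m₀ : ℝ) := by exact_mod_cast hcard
      exact mul_le_mul_of_nonneg_right (mul_le_mul_of_nonneg_right
        (mul_le_mul_of_nonneg_right h1 hαP0) hβ0) (by positivity)
    have hC2 : ((3 : ℝ) ^ d * β) ^ (N - 1) / (1 - (3 : ℝ) ^ d * β)
        ≤ 2 * Real.exp 2 * Real.exp (-((D + D₀ + D₁) / (2 * M) - ρ - 21 / 8)) :=
      htail.trans (mul_le_mul_of_nonneg_left hEN (by positivity))
    have hC0 : 0 ≤ ((3 : ℝ) ^ d * β) ^ (N - 1) / (1 - (3 : ℝ) ^ d * β) :=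
      div_nonneg (pow_nonneg (by positivity) _) (by linarith)
    have hC3 : ((3 : ℝ) ^ d * β) * (2 * Real.exp 2 * Real.exp (-((D + D₀ + D₁) / (2 * M) - ρ - 21 / 8)))
        ≤ Real.exp (-1) * (2 * Real.exp 2 * Real.exp (-((D + D₀ + D₁) / (2 * M) - ρ - 21 / 8))) :=
      mul_le_mul_of_nonneg_right h3β (by positivity)
    calc ‖P * (G - G') * P'‖
        ≤ 2 * (S₀.card * αP * β * (3 : ℝ) ^ d
            * (((3 : ℝ) ^ d * β) ^ (N - 1) / (1 - (3 : ℝ) ^ d * β))) := hwalk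
      _ ≤ 2 * ((m₀ : ℝ) * αP * β * (3 : ℝ) ^ d
            * (2 * Real.exp 2 * Real.exp (-((D + D₀ + D₁) / (2 * M) - ρ - 21 / 8)))) :=
          mul_le_mul_of_nonneg_left (mul_le_mul hC1 hC2 hC0 (by positivity)) two_pos.le
      _ = 2 * (m₀ : ℝ) * αP
          * (((3 : ℝ) ^ d * β) * (2 * Real.exp 2 * Real.exp (-((D + D₀ + D₁) / (2 * M) - ρ - 21 / 8)))) := by
          ring
      _ ≤ 2 * (m₀ : ℝ) * αP
          * (Real.exp (-1) * (2 * Real.exp 2 * Real.exp (-((D + D₀ + D₁) / (2 * M) - ρ - 21 / 8)))) :=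
          mul_le_mul_of_nonneg_left hC3 (by positivity)
      _ = 4 * m₀ * αP * Real.exp (ρ + 29 / 8) * Real.exp (-((D + D₀ + D₁) / (2 * M))) := by
          rw [hexp]; ring
  · -- NEAR (`(D + D₀ + D₁)/(2M) < ρ + 29/8`): the sizes `‖P·G‖, ‖P·G′‖`
    rw [not_le, Nat.lt_one_iff, Nat.floor_eq_zero] at hfar
    have hE : 1 ≤ Real.exp (ρ + 29 / 8) * Real.exp (-((D + D₀ + D₁) / (2 * M))) := by
      rw [← Real.exp_add]
      exact Real.one_le_exp_iff.mpr (by linarith)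
    calc ‖P * (G - G') * P'‖ ≤ ‖P * (G - G')‖ * ‖P'‖ := norm_mul_le _ _
      _ ≤ (2 * m₀ * αP + 2 * m₀ * αP) * 1 := by
          refine mul_le_mul ?_ hnP' (norm_nonneg _) (by positivity)
          rw [Matrix.mul_sub]
          exact (norm_sub_le _ _).trans (add_le_add hPG hPG')
      _ = (4 * m₀ * αP) * 1 := by ring
      _ ≤ (4 * m₀ * αP) * (Real.exp (ρ + 29 / 8) * Real.exp (-((D + D₀ + D₁) / (2 * M)))) :=
          mul_le_mul_of_nonneg_left hE (by positivity)
      _ = 4 * m₀ * αP * Real.exp (ρ + 29 / 8) * Real.exp (-((D + D₀ + D₁) / (2 * M))) := by ring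

end Probe

/-! ## §2. The Hölder probe of (1.9)/(2.14): `P_H = σ·(E_{xx′}[U]·P_{b′} − P_b)` -/

section Holder

variable {X κ : Type*} [Fintype X] [Fintype κ] [DecidableEq X] [DecidableEq κ]

/-- block matrix units multiply like matrix units: `E_{xy}[A]·E_{yz}[B] = E_{xz}[AB]` (the transport `U(A(Γ_{x,x′}))`
of (2.14) composed with the bond difference (1.3) at `x′`). [cite: Balaban1983RegularityDecay, (2.14) p.577, (1.3) p.572] -/
theorem unitOp_mul_unitOp (x y z : X) (A B : Matrix κ κ ℝ) :
    unitOp x y A * unitOp y z B = unitOp x z (A * B) := by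
  unfold unitOp
  rw [blockOp_mul]
  congr 1
  funext u v
  rw [Finset.sum_eq_single y]
  · by_cases hu : u = x
    · by_cases hv : v = z
      · simp [hu, hv]
      · simp [hv]
    · simp [hu]
  · intro w _ hw
    simp [hw]
  · intro hy; exact absurd (Finset.mem_univ y) hy

/-- **THE HÖLDER PROBE IS THE TRANSPORTED DIFFERENCE OF THE TWO BOND-DIFFERENCE OPERATORS**:
`E_{xx′}[U]·(E_{x′y′}[W(x′,y′)] − E_{x′x′}[1]) − (E_{xy}[W(x,y)] − E_{xx}[1]) = E_{xy′}[UW(x′,y′)] − E_{xx′}[U] − (E_{xy}[W(x,y)]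
− E_{xx}[1])`, i.e. `U(A(Γ_{x,x′}))` applied to the covariant bond difference (1.3) at `x′`, minus the one at `x`.
[cite: Balaban1983RegularityDecay, (1.9) p.573, (2.14) p.577] -/
theorem holderOp_eq (x y x' y' : X) (U : Matrix κ κ ℝ) (W : X → X → Matrix κ κ ℝ) (σ : ℝ) :
    σ • (unitOp x x' U * (unitOp x' y' (W x' y') - unitOp x' x' 1) - (unitOp x y (W x y) - unitOp x x 1))
      = σ • (unitOp x y' (U * W x' y') - unitOp x x' U - (unitOp x y (W x y) - unitOp x x 1)) := by
  rw [Matrix.mul_sub, unitOp_mul_unitOp, unitOp_mul_unitOp, Matrix.mul_one]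

/-- `P_H·h = σ·(h(y′)E_{xy′}[UW′] − h(x′)E_{xx′}[U] − (h(y)E_{xy}[W] − h(x)E_{xx}[1]))`: the Hölder probe sees a
function `h` only through its values at the four points `x, y, x′, y′`. [cite: Balaban1983RegularityDecay, (2.3)–(2.4) p.575, (2.18) p.578] -/
theorem holderOp_mul_mulH (x y x' y' : X) (U : Matrix κ κ ℝ) (W : X → X → Matrix κ κ ℝ) (σ : ℝ) (h : X → ℝ) :
    σ • (unitOp x y' (U * W x' y') - unitOp x x' U - (unitOp x y (W x y) - unitOp x x 1)) * mulH (ι := κ) h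
      = σ • (h y' • unitOp x y' (U * W x' y') - h x' • unitOp x x' U
          - (h y • unitOp x y (W x y) - h x • unitOp x x 1)) := by
  rw [Matrix.smul_mul, Matrix.sub_mul, Matrix.sub_mul, Matrix.sub_mul, unitOp_mul_mulH, unitOp_mul_mulH,
    unitOp_mul_mulH, unitOp_mul_mulH]

omit [Fintype κ] [DecidableEq κ] in
/-- the `x`-row of `E_{xy}[B]Φ` is `Bφ(y)` (the evaluation `U(A_b)φ(b₊)` of (1.3)). [cite: Balaban1983RegularityDecay, (1.3) p.572] -/
theorem fld_unitOp_mulVec [Fintype κ] (x y : X) (B : Matrix κ κ ℝ) (Φ : X × κ → ℝ) :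
    fld (unitOp x y B *ᵥ Φ) x = B *ᵥ fld Φ y := by
  unfold unitOp
  rw [fld_blockOp_mulVec, Finset.sum_eq_single y]
  · simp
  · intro z _ hz; simp [hz]
  · intro hy; exact absurd (Finset.mem_univ y) hy

omit [Fintype κ] [DecidableEq X] [DecidableEq κ] in
/-- `fld` is additive in the operator. [folklore] -/
private theorem fld_sub_mulVec [Fintype κ] (A B : Matrix (X × κ) (X × κ) ℝ) (Φ : X × κ → ℝ) (x : X) :
    fld ((A - B) *ᵥ Φ) x = fld (A *ᵥ Φ) x - fld (B *ᵥ Φ) x := by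
  funext k
  simp [fld, Matrix.sub_mulVec]

omit [Fintype κ] [DecidableEq X] [DecidableEq κ] in
/-- `fld` is homogeneous in the operator. [folklore] -/
private theorem fld_smul_mulVec [Fintype κ] (σ : ℝ) (A : Matrix (X × κ) (X × κ) ℝ) (Φ : X × κ → ℝ) (x : X) :
    fld ((σ • A) *ᵥ Φ) x = σ • fld (A *ᵥ Φ) x := by
  funext k
  simp [fld, Matrix.smul_mulVec]

/-- **THE HÖLDER PROBE COMPUTES THE PRINTED HÖLDER DIFFERENCE**: the `x`-row of `P_HΦ` is
`σ·(U(W(x′,y′)φ(y′) − φ(x′)) − (W(x,y)φ(y) − φ(x)))` = `|x−x′|^{−α}(U(A(Γ_{x,x′}))(D^η_AΦ)(b′) − (D^η_AΦ)(b))` up to the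
factor `η⁻¹` of `D^η` carried by the weights. [cite: Balaban1983RegularityDecay, (1.9) p.573, (2.14) p.577] -/
theorem fld_holderOp_mulVec (x y x' y' : X) (U : Matrix κ κ ℝ) (W : X → X → Matrix κ κ ℝ) (σ : ℝ)
    (Φ : X × κ → ℝ) :
    fld ((σ • (unitOp x y' (U * W x' y') - unitOp x x' U - (unitOp x y (W x y) - unitOp x x 1))) *ᵥ Φ) x
      = σ • (U *ᵥ (W x' y' *ᵥ fld Φ y' - fld Φ x') - (W x y *ᵥ fld Φ y - fld Φ x)) := by
  rw [fld_smul_mulVec, fld_sub_mulVec, fld_sub_mulVec, fld_sub_mulVec, fld_unitOp_mulVec, fld_unitOp_mulVec,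
    fld_unitOp_mulVec, fld_unitOp_mulVec, Matrix.one_mulVec, ← Matrix.mulVec_mulVec, Matrix.mulVec_sub]

end Holder

/-! ## §3. THEOREM (1.9), the Hölder member, and the Hölder member of the δG clause (1.11)–(1.12) -/

section Route

variable {X Y κ : Type*} [Fintype X] [Fintype Y] [Fintype κ] [DecidableEq X] [DecidableEq κ] {d : ℕ}

/-- the labels that can see the site `x` number at most `2^d`. [cite: Balaban1983RegularityDecay, §2 p.575] -/
private theorem card_labelBox_le (M : ℝ) (x : Fin d → ℝ) :
    (Fintype.piFinset fun μ => ({⌊x μ / M⌋, ⌊x μ / M⌋ + 1} : Finset ℤ)).card ≤ 2 ^ d := by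
  rw [Fintype.card_piFinset]
  calc ∏ μ, ({⌊x μ / M⌋, ⌊x μ / M⌋ + 1} : Finset ℤ).card ≤ 2 ^ (Finset.univ : Finset (Fin d)).card :=
        Finset.prod_le_pow_card _ _ 2 fun μ _ => Finset.card_le_two
    _ = 2 ^ d := by rw [Finset.card_univ, Fintype.card_fin]

/-- the geometry of the Hölder probe: the cubes seeing one of `x, y, x′, y′` (all within `M/4` of `x`) are at most
`2^{d+2}` in number, all with `|x − Mj|_∞ < (7/8)M`, and the probe annihilates `h_j` for every other label.
[cite: Balaban1983RegularityDecay, §2 p.575, (2.13) p.577] -/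
private theorem holder_probe_geometry {M : ℝ} (hM : 0 < M) (pos : X → Fin d → ℝ) (s : Finset (Fin d → ℤ))
    (W : X → X → Matrix κ κ ℝ) (x y x' y' : X) (hxy : ∀ μ, |pos x μ - pos y μ| ≤ 1 / 8 * M)
    (hxx' : ∀ μ, |pos x μ - pos x' μ| ≤ 1 / 8 * M) (hx'y' : ∀ μ, |pos x' μ - pos y' μ| ≤ 1 / 8 * M)
    (U : Matrix κ κ ℝ) (σ : ℝ) :
    let S₀ : Finset ↥s := Finset.univ.filter fun i : ↥s =>
      hCube M i.1 (pos x) ≠ 0 ∨ hCube M i.1 (pos y) ≠ 0 ∨ hCube M i.1 (pos x') ≠ 0 ∨ hCube M i.1 (pos y') ≠ 0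
    S₀.card ≤ 2 ^ (d + 2)
    ∧ (∀ i : ↥s, i ∉ S₀ →
        σ • (unitOp x y' (U * W x' y') - unitOp x x' U - (unitOp x y (W x y) - unitOp x x 1))
          * mulH (ι := κ) (fun z => hCube M i.1 (pos z)) = 0)
    ∧ (∀ i ∈ S₀, ∀ μ, |pos x μ - M * i.1 μ| < 7 / 8 * M) := by
  classical
  intro S₀
  refine ⟨?_, ?_, ?_⟩
  · have hsub : S₀.map (Function.Embedding.subtype (· ∈ s))
        ⊆ ((Fintype.piFinset fun μ => ({⌊pos x μ / M⌋, ⌊pos x μ / M⌋ + 1} : Finset ℤ))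
          ∪ (Fintype.piFinset fun μ => ({⌊pos y μ / M⌋, ⌊pos y μ / M⌋ + 1} : Finset ℤ)))
          ∪ ((Fintype.piFinset fun μ => ({⌊pos x' μ / M⌋, ⌊pos x' μ / M⌋ + 1} : Finset ℤ))
          ∪ (Fintype.piFinset fun μ => ({⌊pos y' μ / M⌋, ⌊pos y' μ / M⌋ + 1} : Finset ℤ))) := by
      intro j hj
      obtain ⟨i, hi, rfl⟩ := Finset.mem_map.mp hj
      obtain ⟨-, hi4⟩ := Finset.mem_filter.mp hi
      rcases hi4 with h1 | h2 | h3 | h4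
      · exact Finset.mem_union_left _ (Finset.mem_union_left _ (mem_box_of_hCube_ne_zero h1))
      · exact Finset.mem_union_left _ (Finset.mem_union_right _ (mem_box_of_hCube_ne_zero h2))
      · exact Finset.mem_union_right _ (Finset.mem_union_left _ (mem_box_of_hCube_ne_zero h3))
      · exact Finset.mem_union_right _ (Finset.mem_union_right _ (mem_box_of_hCube_ne_zero h4))
    calc S₀.card = (S₀.map (Function.Embedding.subtype (· ∈ s))).card := (Finset.card_map _).symm
      _ ≤ _ := Finset.card_le_card hsub
      _ ≤ _ := Finset.card_union_le _ _
      _ ≤ (2 ^ d + 2 ^ d) + (2 ^ d + 2 ^ d) :=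
          add_le_add ((Finset.card_union_le _ _).trans (add_le_add (card_labelBox_le M (pos x))
            (card_labelBox_le M (pos y)))) ((Finset.card_union_le _ _).trans (add_le_add
            (card_labelBox_le M (pos x')) (card_labelBox_le M (pos y'))))
      _ = 2 ^ (d + 2) := by ring
  · intro i hi
    have hz : ∀ z, (z = x ∨ z = y ∨ z = x' ∨ z = y') → hCube M i.1 (pos z) = 0 := by
      intro z hz
      by_contra hne
      apply hi
      refine Finset.mem_filter.mpr ⟨Finset.mem_univ _, ?_⟩
      rcases hz with rfl | rfl | rfl | rfl
      · exact Or.inl hne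
      · exact Or.inr (Or.inl hne)
      · exact Or.inr (Or.inr (Or.inl hne))
      · exact Or.inr (Or.inr (Or.inr hne))
    rw [holderOp_mul_mulH, hz x (Or.inl rfl), hz y (Or.inr (Or.inl rfl)), hz x' (Or.inr (Or.inr (Or.inl rfl))),
      hz y' (Or.inr (Or.inr (Or.inr rfl)))]
    simp
  · intro i hi μ
    obtain ⟨-, hi4⟩ := Finset.mem_filter.mp hi
    have hnear : ∀ z, (∀ ν, |pos x ν - pos z ν| ≤ 2 / 8 * M) → hCube M i.1 (pos z) ≠ 0 →
        |pos x μ - M * i.1 μ| < 7 / 8 * M := by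
      intro z hz hiz
      calc |pos x μ - M * i.1 μ| = |(pos x μ - pos z μ) + (pos z μ - M * i.1 μ)| := by ring_nf
        _ ≤ |pos x μ - pos z μ| + |pos z μ - M * i.1 μ| := abs_add_le _ _
        _ < 2 / 8 * M + 5 / 8 * M := add_lt_add_of_le_of_lt (hz μ) (hCube_ne_zero_imp hM hiz μ)
        _ = 7 / 8 * M := by ring
    rcases hi4 with h1 | h2 | h3 | h4
    · exact hnear x (fun ν => by rw [sub_self, abs_zero]; positivity) h1
    · exact hnear y (fun ν => (hxy ν).trans (by nlinarith)) h2
    · exact hnear x' (fun ν => (hxx' ν).trans (by nlinarith)) h3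
    · refine hnear y' (fun ν => ?_) h4
      calc |pos x ν - pos y' ν| = |(pos x ν - pos x' ν) + (pos x' ν - pos y' ν)| := by ring_nf
        _ ≤ |pos x ν - pos x' ν| + |pos x' ν - pos y' ν| := abs_add_le _ _
        _ ≤ 1 / 8 * M + 1 / 8 * M := add_le_add (hxx' ν) (hx'y' ν)
        _ = 2 / 8 * M := by ring

/-- **THEOREM (1.9), THE HÖLDER MEMBER, BY THE §2 WALK ROUTE END TO END on [B4]'s concrete operators, for EVERY finite
region and EVERY configuration, modulo the per-cube inputs.**  Data as in `B4Ineq110WalkRoute.ineq110_value`; a pair of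
sites `x, x′` and two weighted bonds `b = ⟨x,y⟩`, `b′ = ⟨x′,y′⟩` with `|x−y|_∞, |x−x′|_∞, |x′−y′|_∞ ≤ M/8`; ANY real `σ`
(standing for `|x−x′|^{−α}`) and ANY `κ×κ` matrix `U` (standing for `U(A(Γ_{x,x′}))`); the Hölder probe
`P_H = σ·(E_{xy′}[UW(x′,y′)] − E_{xx′}[U] − (E_{xy}[W(x,y)] − E_{xx}[1]))` (`holderOp_eq`, `fld_holderOp_mulVec`); the
per-cube HÖLDER input `γ_H ≥ ‖P_H·h_jG_jh_j‖` (print: `c₁` of (2.18), from Lemma 2.2 (2.16) and the Leibniz rules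
(2.3)/(2.4)) and the factor bound `β` with (2.21) `3^dβ ≤ e⁻¹`.  Then for every site set `F` and every
`D ≤ dist_∞(x, F)`:  `‖P_H·G_k(Ω,A)·1_F‖ ≤ 2^{d+3}e^{5/2}γ_H·e^{−D/M}`, i.e. «|x−x′|^{−α}|U(A(Γ_{x,x′}))(D^η_{A,μ}G_kf)(x′)
− (D^η_{A,μ}G_kf)(x)| ≤ c₀e^{−δ₀dist({x,x′},supp f)}‖f‖_∞» with `δ₀ = M⁻¹` (and `dist(x, supp f) ≥ dist({x,x′}, supp f)`).
Instance of `probe_bound`: the probe annihilates `h_j` unless the cube sees one of `x, y, x′, y′` (`≤ 2^{d+2}` cubes,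
all within `(7/8)M` of `x`).  HONEST SCOPE: inputs assumed for every cube (no `R₀`); `|x−x′| ≤ M/8` (farther pairs are
covered by the derivative member at `x` and `x′`); nothing about `α` or `U` is used.
[cite: Balaban1983RegularityDecay, Theorem (1.9) p.573; (2.14) p.577; (2.18)–(2.22) pp.578–579] -/
theorem ineq19_holder {M : ℝ} (hM : 0 < M) (pos : X → Fin d → ℝ) (c : X → X → ℝ) (m2 a : ℝ)
    (q : Y → X → ℝ) (W : X → X → Matrix κ κ ℝ) (T : Y → X → Matrix κ κ ℝ)
    (hc : ∀ x z', c x z' ≠ 0 → ∀ μ, |pos x μ - pos z' μ| ≤ 1 / 8 * M)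
    (hq : ∀ y x z', q y x ≠ 0 → q y z' ≠ 0 → ∀ μ, |pos x μ - pos z' μ| ≤ 1 / 8 * M)
    (s : Finset (Fin d → ℤ)) (hs : ∀ j x, hCube M j (pos x) ≠ 0 → j ∈ s)
    (S : (Fin d → ℤ) → X → Prop) [∀ j, DecidablePred (S j)]
    (hS : ∀ j z, (∀ μ, |pos z μ - M * j μ| ≤ 7 / 8 * M) → S j z)
    (W' : (Fin d → ℤ) → X → X → Matrix κ κ ℝ) (T' : (Fin d → ℤ) → Y → X → Matrix κ κ ℝ)
    (hWW' : ∀ j x z', (∀ μ, |pos x μ - M * j μ| ≤ 3 / 4 * M) → (∀ μ, |pos z' μ - M * j μ| ≤ 3 / 4 * M) →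
      W' j x z' = W x z')
    (hTT' : ∀ j y x, q y x ≠ 0 → (∀ μ, |pos x μ - M * j μ| ≤ 3 / 4 * M) → T' j y x = T y x)
    (Gj : (Fin d → ℤ) → Matrix (X × κ) (X × κ) ℝ)
    (hGj : ∀ j ∈ s, covOp (fun z z' => if (S j z ↔ S j z') then c z z' else 0) m2 a q (W' j) (T' j) * Gj j = 1)
    (G : Matrix (X × κ) (X × κ) ℝ) (hGH : G * covOp c m2 a q W T = 1)
    -- the pair of points, the two bonds, the Hölder weight and the transport
    (x y x' y' : X) (hxy : ∀ μ, |pos x μ - pos y μ| ≤ 1 / 8 * M) (hxx' : ∀ μ, |pos x μ - pos x' μ| ≤ 1 / 8 * M)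
    (hx'y' : ∀ μ, |pos x' μ - pos y' μ| ≤ 1 / 8 * M) (σ : ℝ) (U : Matrix κ κ ℝ)
    -- the analytic inputs
    {γH β : ℝ} (hγH0 : 0 ≤ γH)
    (hγH : ∀ i : ↥s, ‖σ • (unitOp x y' (U * W x' y') - unitOp x x' U - (unitOp x y (W x y) - unitOp x x 1))
        * (mulH (ι := κ) (fun z => hCube M i.1 (pos z)) * Gj i.1 * mulH (ι := κ) (fun z => hCube M i.1 (pos z)))‖
        ≤ γH) (hβ0 : 0 ≤ β)
    (hβ : ∀ i : ↥s, ‖opK (fun z z' => if (S i.1 z ↔ S i.1 z') then c z z' else 0) m2 a q (W' i.1) (T' i.1)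
        (fun z => hCube M i.1 (pos z)) * Gj i.1 * mulH (ι := κ) (fun z => hCube M i.1 (pos z))‖ ≤ β)
    (h3β : (3 : ℝ) ^ d * β ≤ Real.exp (-1))
    -- the support set and its separation from `x`
    (F : X → Prop) [DecidablePred F] {D : ℝ} (hD : ∀ x'', F x'' → ∃ μ, D ≤ |pos x μ - pos x'' μ|) :
    ‖σ • (unitOp x y' (U * W x' y') - unitOp x x' U - (unitOp x y (W x y) - unitOp x x 1)) * G
        * mulH (ι := κ) (fun z => if F z then (1 : ℝ) else 0)‖
      ≤ 2 ^ (d + 3) * Real.exp (5 / 2) * γH * Real.exp (-(D / M)) := by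
  classical
  obtain ⟨hcard, hP0, hρ⟩ := holder_probe_geometry hM pos s W x y x' y' hxy hxx' hx'y' U σ
  have hmain := probe_bound hM pos c m2 a q W T hc hq s hs S hS W' T' hWW' hTT' Gj hGj G hGH
    (σ • (unitOp x y' (U * W x' y') - unitOp x x' U - (unitOp x y (W x y) - unitOp x x 1))) _ hcard hP0 x
    (ρ := 7 / 8) hρ hγH0 hγH hβ0 hβ h3β F hD
  calc _ ≤ 2 * ((2 ^ (d + 2) : ℕ) : ℝ) * γH * Real.exp (7 / 8 + 13 / 8) * Real.exp (-(D / M)) := hmain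
    _ = 2 ^ (d + 3) * Real.exp (5 / 2) * γH * Real.exp (-(D / M)) := by norm_num; ring

/-- **(1.9) AS PRINTED**: for `f` supported in `F` with `sup|f| ≤ φ` and `D ≤ dist_∞(x, F)`, every colour component of
the transported Hölder difference of the covariant bond differences of `G_k(Ω,A)f` obeys
`|σ·(U(W(x′,y′)(Gf)(y′) − (Gf)(x′)) − (W(x,y)(Gf)(y) − (Gf)(x)))_k| ≤ 2^{d+3}e^{5/2}γ_H·e^{−D/M}·φ`.
[cite: Balaban1983RegularityDecay, Theorem (1.9) p.573] -/
theorem ineq19_holder_apply {M : ℝ} (hM : 0 < M) (pos : X → Fin d → ℝ) (c : X → X → ℝ) (m2 a : ℝ)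
    (q : Y → X → ℝ) (W : X → X → Matrix κ κ ℝ) (T : Y → X → Matrix κ κ ℝ)
    (hc : ∀ x z', c x z' ≠ 0 → ∀ μ, |pos x μ - pos z' μ| ≤ 1 / 8 * M)
    (hq : ∀ y x z', q y x ≠ 0 → q y z' ≠ 0 → ∀ μ, |pos x μ - pos z' μ| ≤ 1 / 8 * M)
    (s : Finset (Fin d → ℤ)) (hs : ∀ j x, hCube M j (pos x) ≠ 0 → j ∈ s)
    (S : (Fin d → ℤ) → X → Prop) [∀ j, DecidablePred (S j)]
    (hS : ∀ j z, (∀ μ, |pos z μ - M * j μ| ≤ 7 / 8 * M) → S j z)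
    (W' : (Fin d → ℤ) → X → X → Matrix κ κ ℝ) (T' : (Fin d → ℤ) → Y → X → Matrix κ κ ℝ)
    (hWW' : ∀ j x z', (∀ μ, |pos x μ - M * j μ| ≤ 3 / 4 * M) → (∀ μ, |pos z' μ - M * j μ| ≤ 3 / 4 * M) →
      W' j x z' = W x z')
    (hTT' : ∀ j y x, q y x ≠ 0 → (∀ μ, |pos x μ - M * j μ| ≤ 3 / 4 * M) → T' j y x = T y x)
    (Gj : (Fin d → ℤ) → Matrix (X × κ) (X × κ) ℝ)
    (hGj : ∀ j ∈ s, covOp (fun z z' => if (S j z ↔ S j z') then c z z' else 0) m2 a q (W' j) (T' j) * Gj j = 1)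
    (G : Matrix (X × κ) (X × κ) ℝ) (hGH : G * covOp c m2 a q W T = 1)
    (x y x' y' : X) (hxy : ∀ μ, |pos x μ - pos y μ| ≤ 1 / 8 * M) (hxx' : ∀ μ, |pos x μ - pos x' μ| ≤ 1 / 8 * M)
    (hx'y' : ∀ μ, |pos x' μ - pos y' μ| ≤ 1 / 8 * M) (σ : ℝ) (U : Matrix κ κ ℝ)
    {γH β : ℝ} (hγH0 : 0 ≤ γH)
    (hγH : ∀ i : ↥s, ‖σ • (unitOp x y' (U * W x' y') - unitOp x x' U - (unitOp x y (W x y) - unitOp x x 1))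
        * (mulH (ι := κ) (fun z => hCube M i.1 (pos z)) * Gj i.1 * mulH (ι := κ) (fun z => hCube M i.1 (pos z)))‖
        ≤ γH) (hβ0 : 0 ≤ β)
    (hβ : ∀ i : ↥s, ‖opK (fun z z' => if (S i.1 z ↔ S i.1 z') then c z z' else 0) m2 a q (W' i.1) (T' i.1)
        (fun z => hCube M i.1 (pos z)) * Gj i.1 * mulH (ι := κ) (fun z => hCube M i.1 (pos z))‖ ≤ β)
    (h3β : (3 : ℝ) ^ d * β ≤ Real.exp (-1))
    (F : X → Prop) [DecidablePred F] {D : ℝ} (hD : ∀ x'', F x'' → ∃ μ, D ≤ |pos x μ - pos x'' μ|)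
    (f : X × κ → ℝ) (hfF : ∀ p, ¬ F p.1 → f p = 0) {φ : ℝ} (hφ : 0 ≤ φ) (hf : ∀ p, |f p| ≤ φ) (k : κ) :
    |(σ • (U *ᵥ (W x' y' *ᵥ fld (G *ᵥ f) y' - fld (G *ᵥ f) x') - (W x y *ᵥ fld (G *ᵥ f) y - fld (G *ᵥ f) x))) k|
      ≤ 2 ^ (d + 3) * Real.exp (5 / 2) * γH * Real.exp (-(D / M)) * φ := by
  have hmain := ineq19_holder hM pos c m2 a q W T hc hq s hs S hS W' T' hWW' hTT' Gj hGj G hGH x y x' y' hxy hxx'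
    hx'y' σ U hγH0 hγH hβ0 hβ h3β F hD
  have hP'f : mulH (ι := κ) (fun z => if F z then (1 : ℝ) else 0) *ᵥ f = f := by
    ext p
    rw [mulH_mulVec_apply]
    by_cases hz : F p.1
    · rw [if_pos hz, one_mul]
    · rw [if_neg hz, zero_mul, hfF p hz]
  have hentry : ((σ • (unitOp x y' (U * W x' y') - unitOp x x' U - (unitOp x y (W x y) - unitOp x x 1)) * G
      * mulH (ι := κ) (fun z => if F z then (1 : ℝ) else 0)) *ᵥ f) (x, k)
      = (σ • (U *ᵥ (W x' y' *ᵥ fld (G *ᵥ f) y' - fld (G *ᵥ f) x')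
          - (W x y *ᵥ fld (G *ᵥ f) y - fld (G *ᵥ f) x))) k := by
    rw [← Matrix.mulVec_mulVec, ← Matrix.mulVec_mulVec, hP'f,
      ← fld_apply ((σ • (unitOp x y' (U * W x' y') - unitOp x x' U - (unitOp x y (W x y) - unitOp x x 1)))
        *ᵥ (G *ᵥ f)) x k, fld_holderOp_mulVec]
  rw [← hentry]
  exact (abs_mulVec_le _ f hφ hf (x, k)).trans (mul_le_mul_of_nonneg_right hmain hφ)

/-- **THE HÖLDER MEMBER OF THE δG CLAUSE (1.11)–(1.12)** («we have the inequalities (1.5) and (1.6) … with the additional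
factor (1.12)», p. 573), by the cancellation of the two walk expansions, for EVERY pair of regions `Ω ⊂ Ω₀` and EVERY
`A`, modulo the per-cube inputs.  Setting of `B4Ineq112WalkRoute.ineq112_value` and the Hölder probe `P_H` of
`ineq19_holder` (inputs `γ_H` for both cube families, `β`).  For every site set `F` and `D ≤ dist_∞(x,F)`,
`D₀ ≤ dist_∞(x,Ω^c)`, `D₁ ≤ dist_∞(F,Ω^c)`:  `‖P_H·(G_k(Ω,A) − G_k(Ω₀,A))·1_F‖ ≤ 2^{d+4}e^{9/2}γ_H·exp(−(D + D₀ + D₁)/(2M))`.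
Instance of `probe_delta_bound` (`ρ = 7/8`, `m₀ = 2^{d+2}`).  HONEST SCOPE as in `ineq19_holder`.
[cite: Balaban1983RegularityDecay, Theorem (1.9), (1.11)–(1.12) p.573; p.579; Cor. 2.3 p.581] -/
theorem ineq112_holder {M : ℝ} (hM : 0 < M) (pos : X → Fin d → ℝ) (c : X → X → ℝ) (m2 a : ℝ)
    (q : Y → X → ℝ) (W : X → X → Matrix κ κ ℝ) (T : Y → X → Matrix κ κ ℝ)
    (hc : ∀ x z', c x z' ≠ 0 → ∀ μ, |pos x μ - pos z' μ| ≤ 1 / 8 * M)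
    (hq : ∀ y x z', q y x ≠ 0 → q y z' ≠ 0 → ∀ μ, |pos x μ - pos z' μ| ≤ 1 / 8 * M)
    (s : Finset (Fin d → ℤ)) (hs : ∀ j x, hCube M j (pos x) ≠ 0 → j ∈ s)
    (S : (Fin d → ℤ) → X → Prop) [∀ j, DecidablePred (S j)]
    (hS : ∀ j z, (∀ μ, |pos z μ - M * j μ| ≤ 7 / 8 * M) → S j z)
    (hS1 : ∀ j z, S j z → ∀ μ, |pos z μ - M * j μ| ≤ M)
    (hSq : ∀ j y z z', q y z ≠ 0 → q y z' ≠ 0 → (S j z ↔ S j z'))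
    (W' : (Fin d → ℤ) → X → X → Matrix κ κ ℝ) (T' : (Fin d → ℤ) → Y → X → Matrix κ κ ℝ)
    (hWW' : ∀ j x z', (∀ μ, |pos x μ - M * j μ| ≤ 3 / 4 * M) → (∀ μ, |pos z' μ - M * j μ| ≤ 3 / 4 * M) →
      W' j x z' = W x z')
    (hTT' : ∀ j y x, q y x ≠ 0 → (∀ μ, |pos x μ - M * j μ| ≤ 3 / 4 * M) → T' j y x = T y x)
    (Ω : X → Prop) [DecidablePred Ω]
    (Gj : (Fin d → ℤ) → Matrix (X × κ) (X × κ) ℝ)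
    (hGj : ∀ j ∈ s, covOp (fun z z' => if (S j z ↔ S j z') then c z z' else 0) m2 a q (W' j) (T' j) * Gj j = 1)
    (GjΩ : (Fin d → ℤ) → Matrix (X × κ) (X × κ) ℝ)
    (hGjΩ : ∀ j ∈ s, covOp (fun z z' => if (S j z ↔ S j z') then (if (Ω z ↔ Ω z') then c z z' else 0) else 0)
      m2 a q (W' j) (T' j) * GjΩ j = 1)
    (G : Matrix (X × κ) (X × κ) ℝ) (hGH : G * covOp (fun z z' => if (Ω z ↔ Ω z') then c z z' else 0) m2 a q W T = 1)
    (G' : Matrix (X × κ) (X × κ) ℝ) (hG'H : G' * covOp c m2 a q W T = 1)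
    (x y x' y' : X) (hxy : ∀ μ, |pos x μ - pos y μ| ≤ 1 / 8 * M) (hxx' : ∀ μ, |pos x μ - pos x' μ| ≤ 1 / 8 * M)
    (hx'y' : ∀ μ, |pos x' μ - pos y' μ| ≤ 1 / 8 * M) (σ : ℝ) (U : Matrix κ κ ℝ)
    {γH β : ℝ} (hγH0 : 0 ≤ γH)
    (hγH : ∀ i : ↥s, ‖σ • (unitOp x y' (U * W x' y') - unitOp x x' U - (unitOp x y (W x y) - unitOp x x 1))
        * (mulH (ι := κ) (fun z => hCube M i.1 (pos z)) * Gj i.1 * mulH (ι := κ) (fun z => hCube M i.1 (pos z)))‖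
        ≤ γH)
    (hγHΩ : ∀ i : ↥s, ‖σ • (unitOp x y' (U * W x' y') - unitOp x x' U - (unitOp x y (W x y) - unitOp x x 1))
        * (mulH (ι := κ) (fun z => hCube M i.1 (pos z)) * GjΩ i.1 * mulH (ι := κ) (fun z => hCube M i.1 (pos z)))‖
        ≤ γH) (hβ0 : 0 ≤ β)
    (hβ : ∀ i : ↥s, ‖opK (fun z z' => if (S i.1 z ↔ S i.1 z') then c z z' else 0) m2 a q (W' i.1) (T' i.1)
        (fun z => hCube M i.1 (pos z)) * Gj i.1 * mulH (ι := κ) (fun z => hCube M i.1 (pos z))‖ ≤ β)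
    (hβΩ : ∀ i : ↥s, ‖opK (fun z z' => if (S i.1 z ↔ S i.1 z') then (if (Ω z ↔ Ω z') then c z z' else 0) else 0)
        m2 a q (W' i.1) (T' i.1) (fun z => hCube M i.1 (pos z)) * GjΩ i.1
        * mulH (ι := κ) (fun z => hCube M i.1 (pos z))‖ ≤ β)
    (h3β : (3 : ℝ) ^ d * β ≤ Real.exp (-1))
    (F : X → Prop) [DecidablePred F] {D D₀ D₁ : ℝ}
    (hD : ∀ x'', F x'' → ∃ μ, D ≤ |pos x μ - pos x'' μ|)
    (hD₀ : ∀ x₁, ¬ Ω x₁ → ∃ μ, D₀ ≤ |pos x μ - pos x₁ μ|)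
    (hD₁ : ∀ x'', F x'' → ∀ x₁, ¬ Ω x₁ → ∃ μ, D₁ ≤ |pos x₁ μ - pos x'' μ|) :
    ‖σ • (unitOp x y' (U * W x' y') - unitOp x x' U - (unitOp x y (W x y) - unitOp x x 1)) * (G - G')
        * mulH (ι := κ) (fun z => if F z then (1 : ℝ) else 0)‖
      ≤ 2 ^ (d + 4) * Real.exp (9 / 2) * γH * Real.exp (-((D + D₀ + D₁) / (2 * M))) := by
  classical
  obtain ⟨hcard, hP0, hρ⟩ := holder_probe_geometry hM pos s W x y x' y' hxy hxx' hx'y' U σ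
  have hmain := probe_delta_bound hM pos c m2 a q W T hc hq s hs S hS hS1 hSq W' T' hWW' hTT' Ω Gj hGj GjΩ hGjΩ
    G hGH G' hG'H (σ • (unitOp x y' (U * W x' y') - unitOp x x' U - (unitOp x y (W x y) - unitOp x x 1))) _ hcard
    hP0 x (ρ := 7 / 8) hρ hγH0 hγH hγHΩ hβ0 hβ hβΩ h3β F hD hD₀ hD₁
  calc _ ≤ 4 * ((2 ^ (d + 2) : ℕ) : ℝ) * γH * Real.exp (7 / 8 + 29 / 8)
        * Real.exp (-((D + D₀ + D₁) / (2 * M))) := hmain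
    _ = 2 ^ (d + 4) * Real.exp (9 / 2) * γH * Real.exp (-((D + D₀ + D₁) / (2 * M))) := by norm_num; ring

/-- **THE HÖLDER MEMBER OF (1.11)–(1.12) AS PRINTED**: for `f` supported in `F` with `sup|f| ≤ φ`,
`|σ·(U(W(x′,y′)(δG_kf)(y′) − (δG_kf)(x′)) − (W(x,y)(δG_kf)(y) − (δG_kf)(x)))_k|
≤ 2^{d+4}e^{9/2}γ_H·exp(−(2M)⁻¹(D + D₀ + D₁))·φ`. [cite: Balaban1983RegularityDecay, Theorem (1.9), (1.11)–(1.12) p.573; p.579] -/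
theorem ineq112_holder_apply {M : ℝ} (hM : 0 < M) (pos : X → Fin d → ℝ) (c : X → X → ℝ) (m2 a : ℝ)
    (q : Y → X → ℝ) (W : X → X → Matrix κ κ ℝ) (T : Y → X → Matrix κ κ ℝ)
    (hc : ∀ x z', c x z' ≠ 0 → ∀ μ, |pos x μ - pos z' μ| ≤ 1 / 8 * M)
    (hq : ∀ y x z', q y x ≠ 0 → q y z' ≠ 0 → ∀ μ, |pos x μ - pos z' μ| ≤ 1 / 8 * M)
    (s : Finset (Fin d → ℤ)) (hs : ∀ j x, hCube M j (pos x) ≠ 0 → j ∈ s)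
    (S : (Fin d → ℤ) → X → Prop) [∀ j, DecidablePred (S j)]
    (hS : ∀ j z, (∀ μ, |pos z μ - M * j μ| ≤ 7 / 8 * M) → S j z)
    (hS1 : ∀ j z, S j z → ∀ μ, |pos z μ - M * j μ| ≤ M)
    (hSq : ∀ j y z z', q y z ≠ 0 → q y z' ≠ 0 → (S j z ↔ S j z'))
    (W' : (Fin d → ℤ) → X → X → Matrix κ κ ℝ) (T' : (Fin d → ℤ) → Y → X → Matrix κ κ ℝ)
    (hWW' : ∀ j x z', (∀ μ, |pos x μ - M * j μ| ≤ 3 / 4 * M) → (∀ μ, |pos z' μ - M * j μ| ≤ 3 / 4 * M) →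
      W' j x z' = W x z')
    (hTT' : ∀ j y x, q y x ≠ 0 → (∀ μ, |pos x μ - M * j μ| ≤ 3 / 4 * M) → T' j y x = T y x)
    (Ω : X → Prop) [DecidablePred Ω]
    (Gj : (Fin d → ℤ) → Matrix (X × κ) (X × κ) ℝ)
    (hGj : ∀ j ∈ s, covOp (fun z z' => if (S j z ↔ S j z') then c z z' else 0) m2 a q (W' j) (T' j) * Gj j = 1)
    (GjΩ : (Fin d → ℤ) → Matrix (X × κ) (X × κ) ℝ)
    (hGjΩ : ∀ j ∈ s, covOp (fun z z' => if (S j z ↔ S j z') then (if (Ω z ↔ Ω z') then c z z' else 0) else 0)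
      m2 a q (W' j) (T' j) * GjΩ j = 1)
    (G : Matrix (X × κ) (X × κ) ℝ) (hGH : G * covOp (fun z z' => if (Ω z ↔ Ω z') then c z z' else 0) m2 a q W T = 1)
    (G' : Matrix (X × κ) (X × κ) ℝ) (hG'H : G' * covOp c m2 a q W T = 1)
    (x y x' y' : X) (hxy : ∀ μ, |pos x μ - pos y μ| ≤ 1 / 8 * M) (hxx' : ∀ μ, |pos x μ - pos x' μ| ≤ 1 / 8 * M)
    (hx'y' : ∀ μ, |pos x' μ - pos y' μ| ≤ 1 / 8 * M) (σ : ℝ) (U : Matrix κ κ ℝ)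
    {γH β : ℝ} (hγH0 : 0 ≤ γH)
    (hγH : ∀ i : ↥s, ‖σ • (unitOp x y' (U * W x' y') - unitOp x x' U - (unitOp x y (W x y) - unitOp x x 1))
        * (mulH (ι := κ) (fun z => hCube M i.1 (pos z)) * Gj i.1 * mulH (ι := κ) (fun z => hCube M i.1 (pos z)))‖
        ≤ γH)
    (hγHΩ : ∀ i : ↥s, ‖σ • (unitOp x y' (U * W x' y') - unitOp x x' U - (unitOp x y (W x y) - unitOp x x 1))
        * (mulH (ι := κ) (fun z => hCube M i.1 (pos z)) * GjΩ i.1 * mulH (ι := κ) (fun z => hCube M i.1 (pos z)))‖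
        ≤ γH) (hβ0 : 0 ≤ β)
    (hβ : ∀ i : ↥s, ‖opK (fun z z' => if (S i.1 z ↔ S i.1 z') then c z z' else 0) m2 a q (W' i.1) (T' i.1)
        (fun z => hCube M i.1 (pos z)) * Gj i.1 * mulH (ι := κ) (fun z => hCube M i.1 (pos z))‖ ≤ β)
    (hβΩ : ∀ i : ↥s, ‖opK (fun z z' => if (S i.1 z ↔ S i.1 z') then (if (Ω z ↔ Ω z') then c z z' else 0) else 0)
        m2 a q (W' i.1) (T' i.1) (fun z => hCube M i.1 (pos z)) * GjΩ i.1
        * mulH (ι := κ) (fun z => hCube M i.1 (pos z))‖ ≤ β)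
    (h3β : (3 : ℝ) ^ d * β ≤ Real.exp (-1))
    (F : X → Prop) [DecidablePred F] {D D₀ D₁ : ℝ}
    (hD : ∀ x'', F x'' → ∃ μ, D ≤ |pos x μ - pos x'' μ|)
    (hD₀ : ∀ x₁, ¬ Ω x₁ → ∃ μ, D₀ ≤ |pos x μ - pos x₁ μ|)
    (hD₁ : ∀ x'', F x'' → ∀ x₁, ¬ Ω x₁ → ∃ μ, D₁ ≤ |pos x₁ μ - pos x'' μ|)
    (f : X × κ → ℝ) (hfF : ∀ p, ¬ F p.1 → f p = 0) {φ : ℝ} (hφ : 0 ≤ φ) (hf : ∀ p, |f p| ≤ φ) (k : κ) :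
    |(σ • (U *ᵥ (W x' y' *ᵥ fld ((G - G') *ᵥ f) y' - fld ((G - G') *ᵥ f) x')
        - (W x y *ᵥ fld ((G - G') *ᵥ f) y - fld ((G - G') *ᵥ f) x))) k|
      ≤ 2 ^ (d + 4) * Real.exp (9 / 2) * γH * Real.exp (-((D + D₀ + D₁) / (2 * M))) * φ := by
  have hmain := ineq112_holder hM pos c m2 a q W T hc hq s hs S hS hS1 hSq W' T' hWW' hTT' Ω Gj hGj GjΩ hGjΩ G hGH
    G' hG'H x y x' y' hxy hxx' hx'y' σ U hγH0 hγH hγHΩ hβ0 hβ hβΩ h3β F hD hD₀ hD₁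
  have hP'f : mulH (ι := κ) (fun z => if F z then (1 : ℝ) else 0) *ᵥ f = f := by
    ext p
    rw [mulH_mulVec_apply]
    by_cases hz : F p.1
    · rw [if_pos hz, one_mul]
    · rw [if_neg hz, zero_mul, hfF p hz]
  have hentry : ((σ • (unitOp x y' (U * W x' y') - unitOp x x' U - (unitOp x y (W x y) - unitOp x x 1)) * (G - G')
      * mulH (ι := κ) (fun z => if F z then (1 : ℝ) else 0)) *ᵥ f) (x, k)
      = (σ • (U *ᵥ (W x' y' *ᵥ fld ((G - G') *ᵥ f) y' - fld ((G - G') *ᵥ f) x')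
          - (W x y *ᵥ fld ((G - G') *ᵥ f) y - fld ((G - G') *ᵥ f) x))) k := by
    rw [← Matrix.mulVec_mulVec, ← Matrix.mulVec_mulVec, hP'f,
      ← fld_apply ((σ • (unitOp x y' (U * W x' y') - unitOp x x' U - (unitOp x y (W x y) - unitOp x x 1)))
        *ᵥ ((G - G') *ᵥ f)) x k, fld_holderOp_mulVec]
  rw [← hentry]
  exact (abs_mulVec_le _ f hφ hf (x, k)).trans (mul_le_mul_of_nonneg_right hmain hφ)

end Route

/-! ## §4 (v1.1). The Leibniz reduction (2.3)/(2.4) of the per-cube Hölder input `γ_H` to inputs on `G_k(□_j,Ã_j)`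
itself: «using (2.3), (2.4) and Lemma 2.2 we get (2.18)» -/

section Leibniz

variable {X κ : Type*} [Fintype X] [Fintype κ] [DecidableEq X] [DecidableEq κ]

/-- **THE HÖLDER PROBE PAST A MULTIPLICATION OPERATOR** (the Leibniz rules (2.3)/(2.4) for the Hölder quotient of a
product, in operator form): `P_H·h = h(x)·P_H + σ(h(x′) − h(x))·E_{xx′}[U]P_{b′} + σ(h(y′) − h(x′))·E_{xy′}[UW(x′,y′)]
− σ(h(y) − h(x))·E_{xy}[W(x,y)]` — the probe on `h·(·)` is `h(x)` times the probe, plus a transported bond difference at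
`b′` weighted by the increment of `h` between `x` and `x′`, plus two evaluations weighted by the bond increments of `h`.
[cite: Balaban1983RegularityDecay, (2.3)–(2.4) p.575, (2.18) p.578] -/
theorem holderOp_mul_mulH_expand (x y x' y' : X) (U : Matrix κ κ ℝ) (W : X → X → Matrix κ κ ℝ) (σ : ℝ)
    (h : X → ℝ) :
    σ • (unitOp x y' (U * W x' y') - unitOp x x' U - (unitOp x y (W x y) - unitOp x x 1)) * mulH (ι := κ) h
      = h x • (σ • (unitOp x y' (U * W x' y') - unitOp x x' U - (unitOp x y (W x y) - unitOp x x 1)))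
        + (σ * (h x' - h x)) • (unitOp x y' (U * W x' y') - unitOp x x' U)
        + (σ * (h y' - h x')) • unitOp x y' (U * W x' y')
        - (σ * (h y - h x)) • unitOp x y (W x y) := by
  rw [holderOp_mul_mulH]
  module

/-- **THE PER-CUBE HÖLDER INPUT FROM INPUTS ON THE CUBE PROPAGATOR ITSELF** («using (2.3), (2.4) and Lemma 2.2»):
for any operator `G` (a cube propagator `G_k(□_j,Ã_j)`) and any function `h` with `|h| ≤ 1` (the partition function
`h_j`), the letter input `γ_H ≥ ‖P_H·(hGh)‖` of `ineq19_holder` follows from: `γ_H′ ≥ ‖P_H·G‖` (the Hölder quotient of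
the covariant derivatives of `G` — (2.16), third member of (2.14)), `γ_T ≥ ‖E_{xx′}[U]P_{b′}·G‖` (a transported bond
difference — second member), `γ_V ≥ ‖E_{xy′}[UW′]·G‖, ‖E_{xy}[W]·G‖` (evaluations — first member), and the three
weighted increments of `h`: `θ_a ≥ |σ(h(x′) − h(x))|` (≤ `|x−x′|^{1−α}·sup|∂h_j|`), `θ_b ≥ |σ(h(y′) − h(x′))|,
|σ(h(y) − h(x))|` (≤ `η|x−x′|^{−α}·sup|∂^ηh_j| ≤ η^{1−α}·O(M⁻¹)` on the lattice, `|x−x′| ≥ η`):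
`‖P_H·(hGh)‖ ≤ γ_H′ + θ_aγ_T + 2θ_bγ_V`. [cite: Balaban1983RegularityDecay, (2.3)–(2.4) p.575, (2.14) p.577, (2.16)–(2.18) pp.577–578] -/
theorem norm_holderOp_letter_le (x y x' y' : X) (U : Matrix κ κ ℝ) (W : X → X → Matrix κ κ ℝ) (σ : ℝ)
    (h : X → ℝ) (hh : ∀ z, |h z| ≤ 1) (G : Matrix (X × κ) (X × κ) ℝ) {γH' γT γV θa θb : ℝ}
    (hγT0 : 0 ≤ γT) (hγV0 : 0 ≤ γV)
    (hγH' : ‖σ • (unitOp x y' (U * W x' y') - unitOp x x' U - (unitOp x y (W x y) - unitOp x x 1)) * G‖ ≤ γH')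
    (hγT : ‖(unitOp x y' (U * W x' y') - unitOp x x' U) * G‖ ≤ γT)
    (hγV1 : ‖unitOp x y' (U * W x' y') * G‖ ≤ γV) (hγV2 : ‖unitOp x y (W x y) * G‖ ≤ γV)
    (hθa : |σ * (h x' - h x)| ≤ θa) (hθb1 : |σ * (h y' - h x')| ≤ θb) (hθb2 : |σ * (h y - h x)| ≤ θb) :
    ‖σ • (unitOp x y' (U * W x' y') - unitOp x x' U - (unitOp x y (W x y) - unitOp x x 1))
        * (mulH (ι := κ) h * G * mulH (ι := κ) h)‖ ≤ γH' + θa * γT + 2 * θb * γV := by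
  set PH : Matrix (X × κ) (X × κ) ℝ :=
    σ • (unitOp x y' (U * W x' y') - unitOp x x' U - (unitOp x y (W x y) - unitOp x x 1)) with hPH
  have hnH : ‖mulH (ι := κ) h‖ ≤ 1 := norm_mulH_le _ zero_le_one hh
  have hγH'0 : 0 ≤ γH' := (norm_nonneg _).trans hγH'
  have hθa0 : 0 ≤ θa := (abs_nonneg _).trans hθa
  have hθb0 : 0 ≤ θb := (abs_nonneg _).trans hθb1
  -- push the probe past the left factor `h`
  have hsplit : PH * (mulH (ι := κ) h * G * mulH (ι := κ) h)
      = h x • (PH * G * mulH (ι := κ) h)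
        + (σ * (h x' - h x)) • ((unitOp x y' (U * W x' y') - unitOp x x' U) * G * mulH (ι := κ) h)
        + (σ * (h y' - h x')) • (unitOp x y' (U * W x' y') * G * mulH (ι := κ) h)
        - (σ * (h y - h x)) • (unitOp x y (W x y) * G * mulH (ι := κ) h) := by
    rw [← Matrix.mul_assoc, ← Matrix.mul_assoc, hPH, holderOp_mul_mulH_expand]
    simp only [Matrix.add_mul, Matrix.sub_mul, Matrix.smul_mul]
  -- the size of each term: (scalar) · (input) · ‖h‖
  have hterm : ∀ (c : ℝ) (B : Matrix (X × κ) (X × κ) ℝ) {t b : ℝ}, |c| ≤ t → ‖B‖ ≤ b → 0 ≤ b →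
      ‖c • (B * mulH (ι := κ) h)‖ ≤ t * b := by
    intro c B t b hc hB hb
    rw [norm_smul, Real.norm_eq_abs]
    exact mul_le_mul hc ((norm_mul_le _ _).trans (by
      calc ‖B‖ * ‖mulH (ι := κ) h‖ ≤ b * 1 := mul_le_mul hB hnH (norm_nonneg _) hb
        _ = b := mul_one b)) (norm_nonneg _) ((abs_nonneg _).trans hc)
  have h1 : ‖h x • (PH * G * mulH (ι := κ) h)‖ ≤ 1 * γH' := hterm (h x) (PH * G) (hh x) hγH' hγH'0
  have h2 : ‖(σ * (h x' - h x)) • ((unitOp x y' (U * W x' y') - unitOp x x' U) * G * mulH (ι := κ) h)‖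
      ≤ θa * γT := hterm _ _ hθa hγT hγT0
  have h3 : ‖(σ * (h y' - h x')) • (unitOp x y' (U * W x' y') * G * mulH (ι := κ) h)‖ ≤ θb * γV :=
    hterm _ _ hθb1 hγV1 hγV0
  have h4 : ‖(σ * (h y - h x)) • (unitOp x y (W x y) * G * mulH (ι := κ) h)‖ ≤ θb * γV :=
    hterm _ _ hθb2 hγV2 hγV0
  rw [hsplit]
  calc _ ≤ ‖h x • (PH * G * mulH (ι := κ) h)
          + (σ * (h x' - h x)) • ((unitOp x y' (U * W x' y') - unitOp x x' U) * G * mulH (ι := κ) h)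
          + (σ * (h y' - h x')) • (unitOp x y' (U * W x' y') * G * mulH (ι := κ) h)‖
        + ‖(σ * (h y - h x)) • (unitOp x y (W x y) * G * mulH (ι := κ) h)‖ := norm_sub_le _ _
    _ ≤ (‖h x • (PH * G * mulH (ι := κ) h)‖
          + ‖(σ * (h x' - h x)) • ((unitOp x y' (U * W x' y') - unitOp x x' U) * G * mulH (ι := κ) h)‖
          + ‖(σ * (h y' - h x')) • (unitOp x y' (U * W x' y') * G * mulH (ι := κ) h)‖)
        + ‖(σ * (h y - h x)) • (unitOp x y (W x y) * G * mulH (ι := κ) h)‖ :=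
        by gcongr; exact norm_add₃_le
    _ ≤ (1 * γH' + θa * γT + θb * γV) + θb * γV := by linarith
    _ = γH' + θa * γT + 2 * θb * γV := by ring

end Leibniz

end Literature.MathematicalPhysics.QuantumFieldTheory.Balaban1983to89.B4Ineq19WalkRoute
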